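import Literature.MathematicalPhysics.QuantumFieldTheory.Balaban1983to89.B6Ineq2133TwoScaleV1
import Literature.MathematicalPhysics.QuantumFieldTheory.Balaban1983to89.B6Geom246MultiLevelTorus
import Literature.MathematicalPhysics.QuantumFieldTheory.Balaban1983to89.B6Ineq2134ThetaKLevel

/-!
# `Balaban1983to89.B6Prop26ReachTransplant` — T. Bałaban, *Propagators and renormalization transformations for lattice gauge theories. II*,
# Commun. Math. Phys. **96** (1984) 223–250 [Balaban1984PropagatorsII]: THE GEOMETRY BRIDGE OF PROPOSITION 2.6 — the local operators `G_□`
# of (2.90), living on their own tori `T_□`, READ ON THE GLOBAL LATTICE through the window `□̃³ ⊂ T_η`, and the inequality (2.133) (decay in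
# the torus distance of the `j`-blocks of `T_□`) TRANSPORTED to the `h2133`-shaped local majorant in the multiscale distance `d` of (2.46) that
# the gluing `B6Prop26Gluing.prop26_2136_of_2133_2134_lemma21` consumes; FIRED on the genuine nested box family (`B6Geom246MultiLevelBox`) and
# on the torus family `T_η` (`B6Geom246MultiLevelTorus`) with every geometric input discharged (no existing module is touched; no fact is minted)

statement-level skeleton of published theorems with citation tags; proofs where landed; nothing here is a claim about the Yang–Mills mass gap

PDF held: `paper:balaban1984-cmp96-propagators-rt-ii` (journal page = PDF page + 222); pp. 238–239 [PDF 16–17], p. 247 [PDF 25], p. 231 [PDF 9],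
p. 224 [PDF 2] re-read as page renders (`run/shared/lean/pub/pub-balaban/b2b-balaban-ref1/pages/1984-cmp96-propagators-rt-II/…-p002/p007/p016/
p017/p025-x2.png`) this generation.  Unit `lit-balaban-r03` (B6 fold owner, Phase-2 own lane; r03 gen 18, literature-prover-lit-balaban-r03-g18-0),
HOME `run/shared/lean/pub/lit-balaban/`; B6-CLOSURE.md §5 item 6 **(c)** («THE GEOMETRY BRIDGE», owner's design step after p38's bite (a)
`B6Ineq2133TwoScaleV1` p340300); referee ref-4.  SKELETON rows **B6.Eq2.133** × **B6.Prop2.6** × **B6.Eq2.89** (cells; decls of record untouched).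

## WHAT IS PRINTED (verbatim up to notation)

p. 238–239: *"Let us take a cube □ connected with a L^jη-scale, i.e. either □ ⊂ B^j(Λ_j), or it intersects also B^{j+1}(Λ_{j+1}). A cube □̃ is
obtained from □ by taking a sum of 4^d big blocks … In the same way a cube □̃² is formed … next a cube □̃³, and so on. We take the cube □̃³ and
identify it with a torus, denoted by T_□, imposing periodicity conditions. On this torus we define operators R, Δ_a as in (2.17), (2.19), but only
two scales are present now. … G_□ = (Δ − ∂P_□∂* + Q*aQ)⁻¹. (2.90)  Both operators are defined on the torus T_□. We form an approximation of G
taking as usual G₀ = Σ_{□∈𝒟} h_□G_□h_□."*  p. 247: *"|(G_□J)(x)|, |(∇G_□J)(x)| ≤ O(1)[(L^jη)², L^jη]e^{−δ₂(L^jη)^{−1}dist(Δ,Δ′)}|J|, (2.133) for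
x ∈ Δ(y), supp J ⊂ Δ(y′), y, y′ ∈ 𝔅 ∩ T_□. Applying the inequalities (2.133), (2.88) and the remarks after the inequality (2.68) we obtain
|(K_{□,□′}G_{□′}h_{□′}J)(x)| ≤ O(M^{−1})e^{−½δ₂d(y,y′)}|J| (2.134)"*.  p. 231: *"d(x, x′) = d(y, y′) if x ∈ B^j(y), x′ ∈ B^{j′}(y′)."*

The words *"identify it with a torus"* and *"G₀ = Σ h_□G_□h_□"* hide a change of lattice: `G_□` acts on the bond functions of ITS OWN torus
`T_□`, `h_□` on those of `T_η`; and between (2.133) (decay in the scaled euclidean distance of `T_□`) and (2.134) (decay in the multiscale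
distance `d` of the global block lattice `𝔅`) stands the comparison of the two distances inside the reach of one box — displayed nowhere in print
(cell GAPS G-pv08-1, G-pv01-5 (i): «(2.133) enters already in d-form» in `B6Prop26Gluing`).  In the tree: the two-scale `G_□` and its
(1.110)–(1.114) live on the V1 torus carriers `Site P j` (p22/p38/r03: `B6SectCTwoScaleV1`, `B6Prop25TwoScaleCensus.TSIdx`, `B6Ineq2133TwoScaleV1`),
the global multi-level block lattice `𝔅`, (2.46) and Lemma 2.1 on p21's box/torus carriers `↥(boxDom N₀)` (`B6Geom246MultiLevelBox.geom`,
`B6Geom246MultiLevelTorus.geomT`).  THIS FILE is the dictionary between the two.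

## WHAT THIS FILE CERTIFIES (kernel-checked, sorry-free, standard axioms)

* §1 **TRANSPLANT ALONG A PARTIAL CHART** (any lattices `X` ⊇ window `W` —`e`→ `X′`): `restrictOp` (`ρ`: read a global function on `T_□`,
  zero off `e(W)`), `extendOp` (`ε`: extend by zero), **`transplant W e T′ = ε ∘ T′ ∘ ρ`** — the operator meant by `G_□` inside `h_□G_□h_□`;
  evaluation lemmas; **`localMajorant_transplant`**: a majorant `K′` of `T′` with respect to the local block map (`B6RandomWalk.HasMajorant`), an
  `e`-injective window, a pointwise comparison `K′(blk′(e x), blk′(e x₁)) ≤ K(blk x, blk x₁)` over the reach `S` and «every global block of `S` is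
  charted into `≤ n` local blocks» give `B6Prop26Gluing.LocalMajorant blk (transplant W e T′) S (n·K)` (the source in one global block is cut into
  its `≤ n` local block pieces `B6RandomWalk.blockPiece`, each bounded by the local majorant).
* §2 `expKernel_le_of_dist_le`: `d ≤ κt + c₀ ⟹ A·e^{−δt} ≤ A·e^{δc₀/κ}·e^{−(δ/κ)d}`.
* §3 **THE LOCAL SIDE** for a member `i : TSIdx` (torus `T_□ = Site i.P 0`, `2L^{m+K}` sites per direction, scales `j, j+1`): the chart of a cube
  `siteOfInt` (`val_siteOfInt`), **blocks ↦ blocks** `rep_iterBlockOf_siteOfInt` (the `j`-block of the charted point has labels `⌊z_μ/L^j⌋`, V1's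
  `val_iterBlockOf`), and **`supNorm_sub_le_tdist`**: for two points of a window of side `≤ L^{m+K}` (half the fine period — no pair of charted
  blocks is closer across the torus than inside the window, `torusSupNorm_of_centred`), `|z − z₁|_∞ ≤ L^j·|y(z) − y(z₁)|_T + (L^j − 1)` with
  r03's `TSIdx.tdist` (the distance of p38's majorant).
* §4 **THE BRIDGE** `localMajorant_transplant_of_window`: for ANY global block geometry `g` with integer bond coordinates `pos`/`dir`, a window
  `InWindow pos x₀ W` (`W ≤ L^{m+K}`), the bond chart `chartBond` (injective on the window, `injOn_chartBond`), a local operator `T′` with majorant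
  `A·e^{−δ|y−y′|_T}` on the `j`-blocks of `T_□`, the comparison `d(blk x, blk x₁) ≤ κ·|pos x − pos x₁|_∞/L^j + c` on the window and the fibre
  count `n`: `LocalMajorant blk (transplant … T′) S (n·A·e^{δ(κ+c)/κ}·e^{−(δ/κ)d})`; **`reach2133_G` / `reach2133_DG`**: p38's
  `ineq2133_G`/`ineq2133_DG` (ONE `δ₂ > 0`, ONE `A ≥ 0` on `d, L, a₀, a₁`, before everything) through the bridge, for `G_□` and every `∇_λG_□`.
* §5 **FIRED ON THE GENUINE NESTED BOX FAMILY** `D : B6MultiLevelBoxOperator.Domains` (global bonds `BoxBond` = (box site, direction), block map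
  `blkBond D b = y(b₋)`): `hglob_box` — the comparison with `κ = c = d+1` IS p21's `dist_blkOf_le_box` (windows are coordinatewise convex);
  `hfib_box` — over a block of level `j` or `j+1` meeting a window with corner `x₀ ∈ L^jℤ^{d+1}` there are `≤ L^{d+1}` charted `j`-blocks (a block
  of level `j+1` IS a cube of `L^{d+1}` blocks of level `j`; `coord_bounds`, `rep` injective); **`reach2133_G_box` / `reach2133_DG_box`**: for every
  member `G_□`, every `D` (`M_h ≥ 1`, `P_μ ≥ 1`), every window all of whose box sites have level `j` or `j+1`, every finite set `W` of window bonds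
  and every reach `S ⊂ 𝔅`, `LocalMajorant (g := geom D) (blkBond D) (transplant W (chartBond …) (onFun G_□)) S
  (L^{d+1}·A·e^{2δ₂}·e^{−(δ₂/(d+1))·d(y,y′)})` — LITERALLY the hypothesis `h2133` of `B6Prop26Gluing.prop26_2136_of_2133_2134_lemma21` (with
  `P ≡ 1`) for `Gl □ := transplant … (onFun G_□)`.
* §6 **THE SAME ON `T_η`** (p21's `TDomains`, `geomT`, bonds across the torus): `hglob_torus` (`distT_le_dist_box`), **`reach2133_G_torus`** for
  windows of the fundamental box.
* §7 (**v1.1**, append-only; r03 gen 18 after p38 gen 24's `B6Ineq2134ThetaKLevel` p341566 fixed the carriers of the (2.134) files) **THE SAME ON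
  p38's CARRIERS, IN PRINT'S UNITS**: member `i : KIdx d ℓ`, geometry `geoB i` (`geoB_dist` = p21's (2.46), `geoB_len y = L^{j(y)}η`, `η = L^{−k}`),
  bonds `XV i = Fin (d+1) × ↥i.XB`, block map `blkV i`; generic inputs `hglob_sites`/`hfib_sites` (any lattice over the box sites),
  `localMajorant_smul_of_le`; the operators **`GlEta t i W x₀ := (L^jη)² • transplant W (chartBond t …) (onFun G_□)`** and `DGlEta` (`(L^jη) • …
  (onFun (∇_λ ∘ G_□))`) — (2.94) *"G^η_□(L^jηb, L^jηb′) = (L^jη)^{−d+2}G^ξ_□(b, b′) … and correspondingly for derivatives of G_□"* read for the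
  operators; **`reach2133_G_geoB`**: `∃ δ_G > 0, C_G ≥ 0 ∀ t i x₀ … W S, (∀ a ∈ S, j ≤ level a) → LocalMajorant (g := geoB i) (blkV i) (GlEta t i W x₀) S
  (fun y″ y′ => C_G * (geoB i).len y″ ^ 2 * e^{−δ_G d(y″,y′)})` — LITERALLY the hypothesis `hG` of `B6Ineq2134ThetaKLevel.ineq2134_kOff_kLevel`
  (`C_G = L^{d+1}·A·e^{2δ₂}`, `δ_G = δ₂/(d+1)`); `reach2133_DG_geoB` (weight `len y″`, every direction).
* §8 (**v1.2**, append-only; asked by p38 gen 25 for (b′)) LOCALISATION: `outLoc_transplant` / `inLoc_transplant` (the transplant writes only on, and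
  reads only from, the blocks met by the window — `B6Prop26Gluing.OutLoc`/`InLoc`), `outLoc_GlEta`, `outLoc_DGlEta`, `inLoc_GlEta` (the `hGout`-type
  hypotheses of `B6Ineq2134Diag.diag_hasMajorant` / `hKout` of the gluing for the transplanted operators).
* §9 (**v1.3**, append-only; B6-CLOSURE §5 item 7 (d3)) **THE BIJECTIVE WINDOW `□̃³ = T_□`** (p. 238 *"We take the cube □̃³ and identify it with a
  torus, denoted by T_□, imposing periodicity conditions"*): `restrictOp_extendOp_of_bij` (`ρ∘ε = 1` for a bijective chart), **`transplant_mul_of_bij`**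
  (the transplant through a bijective window is MULTIPLICATIVE), `transplant_sub`/`_add`/`_smul`, `transplant_one_mul_mulOp`,
  **`transplant_inv_mul_mulOp(_smul)`** / **`hinv_of_bij`**: `D_□G_□ = 1` on `T_□` ⟹ `(c•εM_□ρ − c•εP_□ρ)·(c⁻¹•εG_□ρ)·h_□ = h_□` for `h_□` supported
  in the window — LITERALLY the inversion hypothesis `hinv` of `B6Eq291Generator.eq291` / `hinvl` of `B6GlobalChartV1.prop26_2136_V1_of_2134_eq291`;
  §9b `siteOfInt_val`, **`injOn_chartBond_full`** (injective on any window of side `≤ 2L^{m+K}`), **`surj_chartBond_full`** (a full window is ONTO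
  the bonds of `T_□`); §9c `supNorm_sub_le_tdist_shift` (torus distance = flat distance on a half-period sub-window ANYWHERE in the fundamental
  domain, corner in `L^jℤ^{d+1}`), **`localMajorant_transplant_of_window₂`** and **`reach2133_G₂`/`reach2133_DG₂`**: v1's bridge and (2.133) with
  the window enlarged up to the full period (so that the chart may be the bijection `□̃³ = T_□`) and the reach `S` confined to a half-period
  sub-window — same constants.

## HONEST SCOPE / DIVERGENCES (nothing is inferred from the manuscript; every step is kernel-checked)

(1) `T_□`: print identifies the cube `□̃³` (side `8M` big-block units) itself with a torus; the two-scale members of the tree live on V1 tori of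
side `2L^{m′+K′}` fine sites (`B6Prop25TwoScaleCensus.TSIdx`, all periods equal), so `T_□` here is ANY member torus at least twice as wide as the
charted window (hypothesis `W ≤ L^{m′+K′}`) — a torus possibly LARGER than `□̃³` carrying the copy of the window; the decay constants of
`B6Ineq2133TwoScaleV1` are uniform in the member, so nothing depends on this size, but the member whose `Λ′ ⊂ T^{(j+1)}` matches the level-`(j+1)`
part of the window ((2.89) `B^j(Λ) = □̃² ∩ B^{j+1}(Λ_{j+1})`) is CHOSEN BY THE CONSUMER (this file quantifies over all members and all windows;
it does not construct the cover `𝒟` nor the partition `h_□` — p21's `B6Cover236MultiLevelBlocks` / `B6Eq238MultiLevelTorus.cubeSetT` — nor the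
identity (2.91), B6-CLOSURE §5 item 6 (b)/(d)).  (2) The window is a lattice cube of levels `j, j+1` only («connected with the L^jη-scale»; a cube
meeting the level `j − 1` is charted at scale `j − 1`, p21's `js □`), corner in `L^jℤ^{d+1}`; blocks are charted to blocks because both lineages
label blocks by `⌊x_μ/L^j⌋` (corner convention).  (3) Rates and constants: print passes from `δ₂` in (2.133) to `½δ₂` in (2.134); here the rate
becomes `δ₂/(d+1)` and the constant `L^{d+1}·A·e^{2δ₂}` (the `(d+1)` of p21's `ℓ¹`-walk comparison `dist_blkOf_le_box`, the `L^{d+1}` of the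
level-`(j+1)` blocks of the window, `e^{2δ₂}` from the additive slack `|Δ − Δ′|` vs `|y − y′|`); all depend on `d, L, a₀, a₁` only, as print's
«O(1)», «δ₂(d, L)».  (4) Units: `L^jη = 1` (the `ξ`-lattice units of `T_□`, as in `B6Ineq2133TwoScaleV1`; the `η`-rescaling (2.94) is
`B6Eq294Scaling`), so the weight `P` of `h2133` is `≡ 1`.  (5) The global lattice is p21's fine box / fundamental domain of `T_η` with bonds =
(site, direction) pairs; windows wrapping around `T_η` are not treated here (they go through the translation charts `TDomains.chart` /
`distT_le_dist_chart` of `B6Geom246MultiLevelTorus`, one chart per cube as in `B6Eq238MultiLevelTorus`).  (6) `instDecidableEqPBond`: decidable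
equality of V1 bonds (a structure of two decidable fields), registered here because the tree has none.  (7) v1.1, units: `GlEta`/`DGlEta` carry the
factors `(L^jη)²` / `L^jη` of (2.94) with `η = L^{−k}` of the GLOBAL member (`B6Prop22KLevelCensusEta.nK`), i.e. they are `G_□`, `∇G_□` in print's
`η`-units PROVIDED the global operators of the consumer are in print's units too (as `geoB`/`gpP` are); in the LATTICE units of p21's `mlOp` the
factor would be `L^{2j}` — the consumer of (2.91) decides, this file proves the majorant for the `η`-unit reading and (§5) for the unscaled one.
(8) v1.3, the size of `T_□`: print's `T_□` IS `□̃³` (side `7·M` in `L^jη`-units, periodised); a V1 member torus has side `2L^{m′+K′}`, which is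
never `7M` — so under §9 the fundamental domain of the member (side `2L^{m′+K′} ≥` side of `□̃³`, containing `□̃³`, two-level by (2.2) when
`R·M ≥ 2L^{m′+K′}`) plays the role of `□̃³`: a DECLARED MODEL READING («a torus containing □̃³» instead of «□̃³ itself»); the operators, (2.90), (2.91)
and every estimate are print's, the torus is larger.  No `def … : Prop`, no new hypothesis-shaped
fact; value = typed skeleton + a located gap CLOSED at the geometry level, NOT summit progress.
-/

noncomputable section

open scoped BigOperators
open Finset

namespace Literature.MathematicalPhysics.QuantumFieldTheory.Balaban1983to89.B6Prop26ReachTransplant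

open B6RandomWalk (HasMajorant BlockSupp blockPiece sum_blockPiece blockSupp_blockPiece)
open B6Prop26Gluing (LocalMajorant mulOp mulOp_apply)

/-! ## §1  Transplanting an operator of a local lattice `X′` to the global lattice `X` along a partial chart -/

section Transplant

variable {X X' : Type} [DecidableEq X'] (W : Finset X) (e : X → X')

/-- RESTRICTION TO THE BOX, READ ON THE LOCAL LATTICE: `(ρf)(x′) = Σ_{x ∈ W, e x = x′} f(x)` — for a chart `e` injective on the
window `W` this is `f(x)` at `x′ = e x` and `0` off `e(W)` (the identification of the functions on `□̃³ ⊂ T_η` with functions on the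
torus `T_□`, p. 238: *"We take the cube □̃³ and identify it with a torus, denoted by T_□"*). [cite: Balaban1984PropagatorsII, p.238 (T_□), (2.90)–(2.91) p.239, dictionary] -/
def restrictOp : (X → ℝ) →ₗ[ℝ] (X' → ℝ) where
  toFun f x' := ∑ x ∈ W.filter (fun x => e x = x'), f x
  map_add' f f' := by
    funext x'
    simp only [Pi.add_apply, Finset.sum_add_distrib]
  map_smul' r f := by
    funext x'
    simp only [Pi.smul_apply, smul_eq_mul, RingHom.id_apply, Finset.mul_sum]

/-- EXTENSION BY ZERO, READ ON THE GLOBAL LATTICE: `(εg)(x) = g(e x)` for `x ∈ W`, `0` off the window (the inverse identification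
`T_□ ⊃ □̃³ ⊂ T_η`). [cite: Balaban1984PropagatorsII, p.238 (T_□), (2.90)–(2.91) p.239, dictionary] -/
def extendOp [DecidableEq X] : (X' → ℝ) →ₗ[ℝ] (X → ℝ) where
  toFun g x := if x ∈ W then g (e x) else 0
  map_add' g g' := by
    funext x
    simp only [Pi.add_apply]
    split_ifs <;> simp
  map_smul' r g := by
    funext x
    simp only [Pi.smul_apply, smul_eq_mul, RingHom.id_apply]
    split_ifs <;> simp

/-- **THE TRANSPLANTED OPERATOR** `ε ∘ T′ ∘ ρ`: a linear operator `T′` of the functions on the local lattice `X′` (the torus `T_□` of the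
box, carrying `G_□` of (2.90)) read as an operator of the functions on the global lattice `X` through the window `W` and the chart `e`
— the meaning of `G_□` inside *"G₀ = Σ_{□∈𝒟} h_□G_□h_□"* (p. 239), where `h_□` is supported in the window.
[cite: Balaban1984PropagatorsII, (2.90)–(2.91) p.239, p.238 (T_□)] -/
def transplant [DecidableEq X] (T' : Module.End ℝ (X' → ℝ)) : Module.End ℝ (X → ℝ) :=
  extendOp W e ∘ₗ T' ∘ₗ restrictOp W e

variable {W e}

/-- `ρ` evaluated (the identification «□̃³ ⊂ T_η ↔ T_□», read coordinatewise). [cite: Balaban1984PropagatorsII, p.238 (T_□), dictionary] -/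
theorem restrictOp_apply (f : X → ℝ) (x' : X') : restrictOp W e f x' = ∑ x ∈ W.filter (fun x => e x = x'), f x := rfl

/-- on the image of the window an injective chart reads `(ρf)(e x) = f(x)` (a function on `□̃³ ⊂ T_η` IS a function on `T_□`).
[cite: Balaban1984PropagatorsII, p.238 (T_□), dictionary] -/
theorem restrictOp_apply_of_injOn (hinj : Set.InjOn e ↑W) (f : X → ℝ) {x : X} (hx : x ∈ W) :
    restrictOp W e f (e x) = f x := by
  rw [restrictOp_apply]
  have hfilter : W.filter (fun x₁ => e x₁ = e x) = {x} := by
    ext x₁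
    simp only [Finset.mem_filter, Finset.mem_singleton]
    constructor
    · rintro ⟨hx₁, he⟩
      exact hinj hx₁ hx he
    · rintro rfl
      exact ⟨hx, rfl⟩
  rw [hfilter, Finset.sum_singleton]

/-- off the image of the window `ρf = 0`. [cite: Balaban1984PropagatorsII, p.238 (T_□), dictionary] -/
theorem restrictOp_apply_of_not_mem (f : X → ℝ) {x' : X'} (hx' : ∀ x ∈ W, e x ≠ x') : restrictOp W e f x' = 0 := by
  rw [restrictOp_apply]
  refine Finset.sum_eq_zero fun x hx => ?_
  rw [Finset.mem_filter] at hx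
  exact absurd hx.2 (hx' x hx.1)

/-- for an injective chart, `(ρf)(x′)` is a value of `f` on the window or `0`. [folklore] -/
private theorem restrictOp_eq_or (hinj : Set.InjOn e ↑W) (f : X → ℝ) (x' : X') :
    (∃ x ∈ W, e x = x' ∧ restrictOp W e f x' = f x) ∨ restrictOp W e f x' = 0 := by
  by_cases h : ∃ x ∈ W, e x = x'
  · obtain ⟨x, hx, rfl⟩ := h
    exact Or.inl ⟨x, hx, rfl, restrictOp_apply_of_injOn hinj f hx⟩
  · exact Or.inr (restrictOp_apply_of_not_mem f fun x hx hex => h ⟨x, hx, hex⟩)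

variable [DecidableEq X]

omit [DecidableEq X'] in
/-- `ε` evaluated (extension by zero off the window `□̃³`). [cite: Balaban1984PropagatorsII, p.238 (T_□), dictionary] -/
theorem extendOp_apply (g : X' → ℝ) (x : X) : extendOp W e g x = if x ∈ W then g (e x) else 0 := rfl

/-- the transplanted operator evaluated: `(ε T′ ρ f)(x) = (T′(ρf))(e x)` on the window, `0` off it — `(G_□J)(x)` of (2.133) for `x` in
the window. [cite: Balaban1984PropagatorsII, (2.133) p.247, p.238 (T_□), dictionary] -/
theorem transplant_apply (T' : Module.End ℝ (X' → ℝ)) (f : X → ℝ) (x : X) :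
    transplant W e T' f x = if x ∈ W then T' (restrictOp W e f) (e x) else 0 := rfl

/-- `ρ ∘ ε` is the identity on the image of the window (injective chart): the round trip `T_□ → T_η → T_□` loses nothing on `e(W)`.
[cite: Balaban1984PropagatorsII, p.238 (T_□), dictionary] -/
theorem restrictOp_extendOp_apply (hinj : Set.InjOn e ↑W) (g : X' → ℝ) {x : X} (hx : x ∈ W) :
    restrictOp W e (extendOp W e g) (e x) = g (e x) := by
  rw [restrictOp_apply_of_injOn hinj _ hx, extendOp_apply, if_pos hx]

/-- **TRANSPORT OF A MAJORANT THROUGH THE CHART** (the geometric content of reading (2.133), stated on `T_□` with its own blocks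
and distance, as a bound on the global block lattice `𝔅` with the multiscale distance `d` — cell GAPS G-pv08-1 / G-pv01-5 (i)):
if `T′` has the majorant `K′` with respect to the local block map `blk′` (all pairs), the chart `e` is injective on the window `W`,
the kernels compare — `K′(blk′(e x), blk′(e x₁)) ≤ K(blk x, blk x₁)` for window points over the reach `S` — and every global block
`y ∈ S` is charted into at most `n` local blocks, then the transplanted operator has the LOCAL majorant `n·K` on `S` in the sense of
`B6Prop26Gluing.LocalMajorant` (the hypothesis `h2133` of `…B6Prop26Gluing.prop26_2136_of_2133_2134_lemma21`).
[cite: Balaban1984PropagatorsII, (2.133) p.247 («for x ∈ Δ(y), supp J ⊂ Δ(y′), y, y′ ∈ 𝔅 ∩ T_□»), (2.90)–(2.91) p.239; derivation ours] -/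
theorem localMajorant_transplant {g g' : B6.Geometry} (blk : X → g.Site) (blk' : X' → g'.Site) (S : Set g.Site)
    (hinj : Set.InjOn e ↑W) {T' : Module.End ℝ (X' → ℝ)} {K' : g'.Site → g'.Site → ℝ} (hT' : HasMajorant blk' T' K')
    (K : g.Site → g.Site → ℝ) (hK : ∀ a b, 0 ≤ K a b)
    (hcomp : ∀ x ∈ W, ∀ x₁ ∈ W, blk x ∈ S → blk x₁ ∈ S → K' (blk' (e x)) (blk' (e x₁)) ≤ K (blk x) (blk x₁))
    (n : ℕ) (hfib : ∀ y ∈ S, ∃ T : Finset g'.Site, T.card ≤ n ∧ ∀ x ∈ W, blk x = y → blk' (e x) ∈ T) :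
    LocalMajorant blk (transplant W e T') S (fun a b => n * K a b) := by
  classical
  intro y' hy' μ B hμ x hxS
  obtain ⟨T, hTn, hT⟩ := hfib y' hy'
  have hB : 0 ≤ B := hμ.nonneg
  have hnKB : 0 ≤ (n : ℝ) * K (blk x) y' * B := mul_nonneg (mul_nonneg (Nat.cast_nonneg _) (hK _ _)) hB
  rw [transplant_apply]
  by_cases hxW : x ∈ W
  swap
  · rw [if_neg hxW, abs_zero]
    exact hnKB
  rw [if_pos hxW]
  set ν : X' → ℝ := restrictOp W e μ with hν
  set F : Finset g'.Site := (W.filter (fun x => blk x = y')).image (fun x => blk' (e x)) with hF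
  -- Claim A: `|ν| ≤ B` everywhere, and `ν` lives over the local blocks of `F`
  have hA : ∀ x', |ν x'| ≤ B ∧ (ν x' ≠ 0 → blk' x' ∈ F) := by
    intro x'
    rcases restrictOp_eq_or hinj μ x' with ⟨x₁, hx₁, hex, hval⟩ | h0
    · rw [hν, hval]
      by_cases hb : blk x₁ = y'
      · refine ⟨hμ.bound x₁ hb, fun _ => ?_⟩
        rw [hF, Finset.mem_image]
        exact ⟨x₁, Finset.mem_filter.mpr ⟨hx₁, hb⟩, by rw [hex]⟩
      · rw [hμ.off x₁ hb, abs_zero]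
        exact ⟨hB, fun h => absurd rfl h⟩
    · rw [hν, h0, abs_zero]
      exact ⟨hB, fun h => absurd rfl h⟩
  -- Claim B: `ν = Σ_{b ∈ F} Δ(b)ν`
  have hBsum : ν = ∑ b ∈ F, blockPiece blk' b ν := by
    have hsub : ∑ b ∈ F, blockPiece blk' b ν = ∑ b, blockPiece blk' b ν := by
      refine Finset.sum_subset (Finset.subset_univ F) fun b _ hbF => ?_
      funext x'
      simp only [blockPiece, Pi.zero_apply]
      split_ifs with hbx
      · by_contra hne
        exact hbF (hbx ▸ (hA x').2 hne)
      · rfl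
    rw [hsub, sum_blockPiece]
  -- the pieces and their bounds
  have hpiece : ∀ b ∈ F, |T' (blockPiece blk' b ν) (e x)| ≤ K (blk x) y' * B := by
    intro b hb
    have hsupp : BlockSupp blk' (blockPiece blk' b ν) b B :=
      blockSupp_blockPiece blk' ν b B hB fun x' _ => (hA x').1
    refine (hT' b _ B hsupp (e x)).trans (mul_le_mul_of_nonneg_right ?_ hB)
    obtain ⟨x₁, hx₁, rfl⟩ := Finset.mem_image.mp hb
    obtain ⟨hx₁W, hbx₁⟩ := Finset.mem_filter.mp hx₁
    have h := hcomp x hxW x₁ hx₁W hxS (hbx₁ ▸ hy')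
    rwa [hbx₁] at h
  calc |T' ν (e x)| = |(∑ b ∈ F, T' (blockPiece blk' b ν)) (e x)| := by
          conv_lhs => rw [hBsum]
          rw [map_sum]
    _ = |∑ b ∈ F, T' (blockPiece blk' b ν) (e x)| := by rw [Finset.sum_apply]
    _ ≤ ∑ b ∈ F, |T' (blockPiece blk' b ν) (e x)| := Finset.abs_sum_le_sum_abs _ _
    _ ≤ ∑ b ∈ F, K (blk x) y' * B := Finset.sum_le_sum hpiece
    _ = F.card * (K (blk x) y' * B) := by rw [Finset.sum_const, nsmul_eq_mul]
    _ ≤ n * (K (blk x) y' * B) := by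
          refine mul_le_mul_of_nonneg_right (Nat.cast_le.mpr ?_) (mul_nonneg (hK _ _) hB)
          have hFT : F ⊆ T := by
            intro b hb
            obtain ⟨x₁, hx₁, rfl⟩ := Finset.mem_image.mp hb
            obtain ⟨hx₁W, hbx₁⟩ := Finset.mem_filter.mp hx₁
            exact hT x₁ hx₁W hbx₁
          exact (Finset.card_le_card hFT).trans hTn
    _ = n * K (blk x) y' * B := by ring

end Transplant

/-! ## §2  Exponential majorants: a comparison of distances is a comparison of kernels -/

/-- if `d ≤ κ·t + c₀` then `A·e^{−δt} ≤ A·e^{δc₀/κ}·e^{−(δ/κ)d}` — the torus-distance decay of (2.133) read as a decay in the multiscale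
distance with the rate divided by `κ` (as print's `δ₂ ↦ ½δ₂` between (2.133) and (2.134)). [cite: Balaban1984PropagatorsII, (2.133)–(2.134) p.247; derivation ours] -/
theorem expKernel_le_of_dist_le {A δ κ c₀ t dd : ℝ} (hA : 0 ≤ A) (hδ : 0 ≤ δ) (hκ : 0 < κ) (h : dd ≤ κ * t + c₀) :
    A * Real.exp (-(δ * t)) ≤ A * Real.exp (δ * c₀ / κ) * Real.exp (-(δ / κ * dd)) := by
  rw [mul_assoc, ← Real.exp_add]
  refine mul_le_mul_of_nonneg_left (Real.exp_le_exp.mpr ?_) hA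
  have hk : δ / κ * dd ≤ δ / κ * (κ * t + c₀) := mul_le_mul_of_nonneg_left h (div_nonneg hδ hκ.le)
  have heq : δ / κ * (κ * t + c₀) = δ * t + δ * c₀ / κ := by
    field_simp
  linarith

/-! ## §3  The local side: the torus `T_□` of the two-scale member as a V1 torus `Site P 0`, a cube charted into it, and the torus
distance of the `j`-blocks of charted points against the sup-distance of their coordinates -/

section LocalTorus

open B5Eq118OneStroke (iterBlockOf val_iterBlockOf)
open B6LowerBound2153Torus (rep)
open B5Eq117TorusCarriers (Mk)
open B4ContourShift (supNorm abs_le_supNorm supNorm_nonneg)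
open B4TorusKernel.MultiPeriod (torusSupNorm torusSupNorm_of_centred)
open B6Prop25TwoScaleCensus (TSIdx)

variable {d L : ℕ} {hd : 1 ≤ d + 1} {hL : Odd L ∧ 1 < L} {a₀ a₁ : ℝ} (i : TSIdx d L hd hL a₀ a₁)

/-- **THE CHART OF A CUBE INTO THE TORUS `T_□`**: the integer point `z` (coordinates relative to the corner of the window, `0 ≤ z_μ`)
is sent to the site of `T_□ = T^{(0)}` of the member with labels `z_μ mod 2L^{m+K}` (p. 238: *"We take the cube □̃³ and identify it with
a torus, denoted by T_□, imposing periodicity conditions"*; the member's torus may be larger than `□̃³`, see the module docstring).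
[cite: Balaban1984PropagatorsII, p.238–239 (T_□), dictionary] -/
def siteOfInt (z : Fin (d + 1) → ℤ) : Site i.P 0 := fun μ => (((z μ).toNat : ℕ) : ZMod (i.P.sitesPerDir 0))

/-- the fine period of `T_□`: `2L^{m+K}` sites per direction. [cite: Balaban1987RG1, (0.1) p.251, dictionary] -/
theorem sitesPerDir_zero : i.P.sitesPerDir 0 = 2 * L ^ (i.m + i.K) := by
  simp [Params.sitesPerDir]

/-- the period of the unit lattice `T^{(j)}` of `T_□`: `2L^{m+K−j}`. [cite: Balaban1987RG1, (0.1) p.251, dictionary] -/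
theorem sitesPerDir_j : i.P.sitesPerDir i.j = 2 * L ^ (i.m + i.K - i.j) := by
  simp [Params.sitesPerDir]

/-- inside the window (`0 ≤ z_μ < 2L^{m+K}`) the chart is faithful on labels: `val (siteOfInt z)_μ = z_μ`.
[cite: Balaban1984PropagatorsII, p.238 (T_□); Balaban1984PropagatorsI, (1.6) p.18, dictionary] -/
theorem val_siteOfInt {z : Fin (d + 1) → ℤ} (hz0 : ∀ μ, 0 ≤ z μ) (hzN : ∀ μ, z μ < (i.P.sitesPerDir 0 : ℕ)) (μ : Fin (d + 1)) :
    (((siteOfInt i z μ).val : ℕ) : ℤ) = z μ := by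
  have hlt : (z μ).toNat < i.P.sitesPerDir 0 := by
    have := hzN μ
    have := hz0 μ
    omega
  simp only [siteOfInt, ZMod.val_natCast, Nat.mod_eq_of_lt hlt]
  exact Int.toNat_of_nonneg (hz0 μ)

/-- **BLOCKS ARE CHARTED TO BLOCKS**: the label of the `j`-block of the charted point is `⌊z_μ/L^j⌋` (V1's corner labelling
`val_iterBlockOf`; so a window whose corner lies in `L^jℤ^{d+1}` has its `L^j`-blocks charted onto `j`-blocks of `T_□`).
[cite: Balaban1984PropagatorsI, (1.6) p.18, (1.18) p.20, dictionary] -/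
theorem rep_iterBlockOf_siteOfInt {z : Fin (d + 1) → ℤ} (hz0 : ∀ μ, 0 ≤ z μ) (hzN : ∀ μ, z μ < (i.P.sitesPerDir 0 : ℕ))
    (μ : Fin (d + 1)) : rep (Mk i.P i.j) (iterBlockOf i.j (siteOfInt i z)) μ = z μ / ((L ^ i.j : ℕ) : ℤ) := by
  show (((iterBlockOf i.j (siteOfInt i z)) μ).val : ℤ) = z μ / ((L ^ i.j : ℕ) : ℤ)
  rw [val_iterBlockOf i.j (Nat.le_of_succ_le i.hjP), Int.natCast_div, val_siteOfInt i hz0 hzN μ]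

/-- floor division by `n > 0` is `n`-Lipschitz up to the remainder: `|a − b| ≤ n·|⌊a/n⌋ − ⌊b/n⌋| + (n − 1)`. [folklore] -/
private theorem abs_sub_le_mul_abs_ediv_sub (n : ℤ) (hn : 0 < n) (a b : ℤ) : |a - b| ≤ n * |a / n - b / n| + (n - 1) := by
  have ha := Int.emod_def a n
  have hb := Int.emod_def b n
  have hra0 := Int.emod_nonneg a hn.ne'
  have hrb0 := Int.emod_nonneg b hn.ne'
  have hra := Int.emod_lt_of_pos a hn
  have hrb := Int.emod_lt_of_pos b hn
  have hsplit : a - b = n * (a / n - b / n) + (a % n - b % n) := by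
    rw [mul_sub]
    linarith
  have hr : |a % n - b % n| ≤ n - 1 := by
    rw [abs_le]
    constructor <;> linarith
  calc |a - b| = |n * (a / n - b / n) + (a % n - b % n)| := by rw [hsplit]
    _ ≤ |n * (a / n - b / n)| + |a % n - b % n| := abs_add_le _ _
    _ ≤ n * |a / n - b / n| + (n - 1) := by
        rw [abs_mul, abs_of_pos hn]
        linarith

/-- labels of window points lie in `[0, L^{m+K−j})`: `0 ≤ ⌊z_μ/L^j⌋ < L^{m+K−j}` for `0 ≤ z_μ < L^{m+K}`. [folklore] -/
private theorem ediv_window {z : ℤ} (hz0 : 0 ≤ z) (hzW : z < ((L ^ (i.m + i.K) : ℕ) : ℤ)) :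
    0 ≤ z / ((L ^ i.j : ℕ) : ℤ) ∧ z / ((L ^ i.j : ℕ) : ℤ) < ((L ^ (i.m + i.K - i.j) : ℕ) : ℤ) := by
  have hL0 : 0 < L := by have := hL.2; omega
  have hn : (0 : ℤ) < ((L ^ i.j : ℕ) : ℤ) := by positivity
  refine ⟨Int.ediv_nonneg hz0 hn.le, Int.ediv_lt_of_lt_mul hn ?_⟩
  have hpow : ((L ^ (i.m + i.K) : ℕ) : ℤ) = ((L ^ (i.m + i.K - i.j) : ℕ) : ℤ) * ((L ^ i.j : ℕ) : ℤ) := by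
    rw [← Nat.cast_mul, ← pow_add, Nat.sub_add_cancel (Nat.le_of_succ_le i.hjP)]
  rw [← hpow]
  exact hzW

/-- the window of side `≤ L^{m+K}` lies in the fundamental domain of the fine torus (`2L^{m+K}` sites per direction). [folklore] -/
private theorem lt_sitesPerDir_of_window {w : ℤ} (hw : w < ((L ^ (i.m + i.K) : ℕ) : ℤ)) : w < (i.P.sitesPerDir 0 : ℕ) := by
  rw [sitesPerDir_zero]
  have h0 : (0 : ℤ) ≤ ((L ^ (i.m + i.K) : ℕ) : ℤ) := by positivity
  push_cast at hw h0 ⊢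
  linarith

/-- **THE TORUS DISTANCE OF THE CHARTED BLOCKS CONTROLS THE SUP-DISTANCE OF THE POINTS**: for two points of a window of side
`≤ L^{m+K}` (half the fine period of `T_□`, so that no pair of charted blocks is closer ACROSS the torus than inside the window),
`|z − z₁|_∞ ≤ L^j·|y(z) − y(z₁)|_{T} + (L^j − 1)`, `y(·)` = the `j`-block of the charted point, `|·|_T` = the torus sup-distance of
`T^{(j)}` (r03's `TSIdx.tdist`, the distance of (2.133)'s majorant `B6Ineq2133TwoScaleV1.ineq2133_G`).
[cite: Balaban1984PropagatorsII, (2.133) p.247 («(L^jη)^{−1}dist(Δ, Δ′)»), p.238 (T_□); derivation ours] -/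
theorem supNorm_sub_le_tdist {z z₁ : Fin (d + 1) → ℤ} (hz0 : ∀ μ, 0 ≤ z μ) (hz₁0 : ∀ μ, 0 ≤ z₁ μ)
    (hzW : ∀ μ, z μ < ((L ^ (i.m + i.K) : ℕ) : ℤ)) (hz₁W : ∀ μ, z₁ μ < ((L ^ (i.m + i.K) : ℕ) : ℤ)) :
    supNorm (z - z₁) ≤ ((L ^ i.j : ℕ) : ℝ) * i.tdist (iterBlockOf i.j (siteOfInt i z)) (iterBlockOf i.j (siteOfInt i z₁)) +
      (((L ^ i.j : ℕ) : ℝ) - 1) := by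
  have hL0 : 0 < L := by have := hL.2; omega
  have hn : (0 : ℤ) < ((L ^ i.j : ℕ) : ℤ) := by positivity
  have hzN : ∀ μ, z μ < (i.P.sitesPerDir 0 : ℕ) := fun μ => lt_sitesPerDir_of_window i (hzW μ)
  have hz₁N : ∀ μ, z₁ μ < (i.P.sitesPerDir 0 : ℕ) := fun μ => lt_sitesPerDir_of_window i (hz₁W μ)
  set q : Fin (d + 1) → ℤ := rep (Mk i.P i.j) (iterBlockOf i.j (siteOfInt i z)) with hqdef
  set q₁ : Fin (d + 1) → ℤ := rep (Mk i.P i.j) (iterBlockOf i.j (siteOfInt i z₁)) with hq₁def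
  have hq : ∀ μ, q μ = z μ / ((L ^ i.j : ℕ) : ℤ) := fun μ => rep_iterBlockOf_siteOfInt i hz0 hzN μ
  have hq₁ : ∀ μ, q₁ μ = z₁ μ / ((L ^ i.j : ℕ) : ℤ) := fun μ => rep_iterBlockOf_siteOfInt i hz₁0 hz₁N μ
  -- the label difference is centred, so the torus distance of the labels is their sup-distance
  have hcen : ∀ μ, 2 * |(q - q₁) μ| ≤ (Mk i.P i.j μ : ℤ) := by
    intro μ
    have hM : (Mk i.P i.j μ : ℤ) = 2 * ((L ^ (i.m + i.K - i.j) : ℕ) : ℤ) := by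
      show ((i.P.sitesPerDir i.j : ℕ) : ℤ) = _
      rw [sitesPerDir_j]
      push_cast
      ring
    rw [hM, Pi.sub_apply, hq μ, hq₁ μ]
    obtain ⟨ha0, ha⟩ := ediv_window i (hz0 μ) (hzW μ)
    obtain ⟨hb0, hb⟩ := ediv_window i (hz₁0 μ) (hz₁W μ)
    have habs : |z μ / ((L ^ i.j : ℕ) : ℤ) - z₁ μ / ((L ^ i.j : ℕ) : ℤ)| ≤ ((L ^ (i.m + i.K - i.j) : ℕ) : ℤ) := by
      rw [abs_le]
      constructor <;> linarith
    linarith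
  have htd : i.tdist (iterBlockOf i.j (siteOfInt i z)) (iterBlockOf i.j (siteOfInt i z₁)) = supNorm (q - q₁) := by
    show torusSupNorm (Mk i.P i.j) (q - q₁) = supNorm (q - q₁)
    exact torusSupNorm_of_centred (fun μ => NeZero.one_le) hcen
  rw [htd]
  -- coordinatewise
  have hnR : (0 : ℝ) ≤ ((L ^ i.j : ℕ) : ℝ) := by positivity
  unfold supNorm
  refine Finset.sup'_le _ _ fun μ _ => ?_
  have hμ : ((|(q - q₁) μ| : ℤ) : ℝ) ≤ Finset.univ.sup' Finset.univ_nonempty (fun ν => ((|(q - q₁) ν| : ℤ) : ℝ)) :=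
    abs_le_supNorm (q - q₁) μ
  have hint : |(z - z₁) μ| ≤ ((L ^ i.j : ℕ) : ℤ) * |(q - q₁) μ| + (((L ^ i.j : ℕ) : ℤ) - 1) := by
    rw [Pi.sub_apply, Pi.sub_apply, hq μ, hq₁ μ]
    exact abs_sub_le_mul_abs_ediv_sub _ hn _ _
  have hcast : ((|(z - z₁) μ| : ℤ) : ℝ) ≤ ((L ^ i.j : ℕ) : ℝ) * ((|(q - q₁) μ| : ℤ) : ℝ) + (((L ^ i.j : ℕ) : ℝ) - 1) := by
    have := (Int.cast_le (R := ℝ)).mpr hint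
    push_cast at this ⊢
    exact this
  nlinarith [mul_le_mul_of_nonneg_left hμ hnR]

end LocalTorus

/-! ## §4  The bridge: (2.133) on `T_□` (torus distance of the `j`-blocks) ⟹ the `h2133`-shaped local majorant on ANY global block
geometry whose distance is controlled by the sup-distance of coordinates inside the window -/

section Bridge

open B5Eq118OneStroke (iterBlockOf)
open B4ContourShift (supNorm supNorm_nonneg)
open B6Prop25TwoScaleCensus (TSIdx)
open B6Ineq2133TwoScaleV1 (tsGeo onFun ineq2133_G ineq2133_DG)

variable {d L : ℕ} {hd : 1 ≤ d + 1} {hL : Odd L ∧ 1 < L} {a₀ a₁ : ℝ} (i : TSIdx d L hd hL a₀ a₁)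

/-- decidable equality of bonds `⟨x, μ⟩` (a bond is determined by its initial point and direction; needed to read bond functions of
`T_□` through the chart). [folklore] -/
instance instDecidableEqPBond (P : Params) (j : ℕ) : DecidableEq (PBond P j) := fun b b' =>
  decidable_of_iff (b.src = b'.src ∧ b.dir = b'.dir)
    ⟨fun h => by
      cases b
      cases b'
      obtain ⟨h1, h2⟩ := h
      simp only at h1 h2
      subst h1
      subst h2
      rfl,
     fun h => h ▸ ⟨rfl, rfl⟩⟩

/-- **THE WINDOW CHART ON BONDS**: a global lattice `X` of bonds with integer coordinates `pos` (of the initial point) and directions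
`dir` is charted into the bonds of `T_□` by `x ↦ ⟨siteOfInt (pos x − x₀), dir x⟩`, `x₀` = the corner of the window (the identification
«□̃³ ⊂ T_η ↔ T_□» of p. 238 on bonds). [cite: Balaban1984PropagatorsII, p.238–239 (T_□), p.224 («Ω also the set of bonds»), dictionary] -/
def chartBond {X : Type} (pos : X → Fin (d + 1) → ℤ) (dir : X → Fin (d + 1)) (x₀ : Fin (d + 1) → ℤ) (x : X) : PBond i.P 0 :=
  ⟨siteOfInt i (fun μ => pos x μ - x₀ μ), dir x⟩

/-- the block of the charted bond is the `j`-block of the charted initial point. [cite: Balaban1984PropagatorsII, (2.133) p.247 («x ∈ Δ(y)»), dictionary] -/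
@[simp] theorem chartBond_src {X : Type} (pos : X → Fin (d + 1) → ℤ) (dir : X → Fin (d + 1)) (x₀ : Fin (d + 1) → ℤ) (x : X) :
    (chartBond i pos dir x₀ x).src = siteOfInt i (fun μ => pos x μ - x₀ μ) := rfl

/-- **THE WINDOW**: `x₀ ≤ pos x < x₀ + W` coordinatewise, `W ≤ L^{m+K}` (half the fine period of `T_□`).
[cite: Balaban1984PropagatorsII, p.238 («a cube □̃³ … identify it with a torus»), dictionary] -/
def InWindow {X : Type} (pos : X → Fin (d + 1) → ℤ) (x₀ : Fin (d + 1) → ℤ) (Wd : ℕ) (x : X) : Prop :=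
  ∀ μ, x₀ μ ≤ pos x μ ∧ pos x μ < x₀ μ + Wd

/-- the chart is injective on a window on which `(pos, dir)` is (the identification «□̃³ ↔ T_□» is one-to-one on a cube of side at
most half the period). [cite: Balaban1984PropagatorsII, p.238 (T_□), dictionary] -/
theorem injOn_chartBond {X : Type} (pos : X → Fin (d + 1) → ℤ) (dir : X → Fin (d + 1)) (x₀ : Fin (d + 1) → ℤ) {Wd : ℕ}
    (hWd : Wd ≤ L ^ (i.m + i.K)) (W : Finset X) (hW : ∀ x ∈ W, InWindow pos x₀ Wd x)
    (hinj : Set.InjOn (fun x => (pos x, dir x)) ↑W) : Set.InjOn (chartBond i pos dir x₀) ↑W := by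
  intro x hx x₁ hx₁ h
  have hwin : ∀ {x}, x ∈ W → (∀ μ, 0 ≤ pos x μ - x₀ μ) ∧ ∀ μ, pos x μ - x₀ μ < (i.P.sitesPerDir 0 : ℕ) := by
    intro x hx
    refine ⟨fun μ => by have := (hW x hx μ).1; linarith, fun μ => lt_sitesPerDir_of_window i ?_⟩
    have := (hW x hx μ).2
    have hc : ((Wd : ℕ) : ℤ) ≤ ((L ^ (i.m + i.K) : ℕ) : ℤ) := by exact_mod_cast hWd
    linarith
  have hsrc := congrArg PBond.src h
  have hdir : dir x = dir x₁ := congrArg PBond.dir h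
  simp only [chartBond_src] at hsrc
  have hpos : pos x = pos x₁ := by
    funext μ
    have h1 := val_siteOfInt i (hwin hx).1 (hwin hx).2 μ
    have h2 := val_siteOfInt i (hwin hx₁).1 (hwin hx₁).2 μ
    have h3 : (siteOfInt i (fun μ => pos x μ - x₀ μ) μ).val = (siteOfInt i (fun μ => pos x₁ μ - x₀ μ) μ).val := by rw [hsrc]
    have : pos x μ - x₀ μ = pos x₁ μ - x₀ μ := by rw [← h1, ← h2, h3]
    linarith
  exact hinj hx hx₁ (Prod.ext hpos hdir)

/-- **THE BRIDGE** (B6-CLOSURE §5 item 6 (c)): let the operator `T′` of the bond functions of `T_□` have the majorant `A·e^{−δ|y−y′|_T}`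
with respect to the `j`-blocks (the shape of (2.133) certified by `B6Ineq2133TwoScaleV1.ineq2133_G`), and let the global block geometry
`g` (block map `blk`, reach `S`) satisfy, for bonds of the window, `d(blk x, blk x₁) ≤ κ·|pos x − pos x₁|_∞/L^j + c` (for the nested box
family: `B6Geom246MultiLevelBox.dist_blkOf_le_box`, `κ = c = d + 1`) with at most `n` charted `j`-blocks over a global block of `S`.  Then the
transplanted operator has the local majorant `n·A·e^{δ(κ+c)/κ}·e^{−(δ/κ)d(y,y′)}` on `S` — the hypothesis `h2133` of
`B6Prop26Gluing.prop26_2136_of_2133_2134_lemma21` with `P ≡ 1` and the rate `δ/κ` («(2.133) enters already in d-form», cell GAPS G-pv08-1 /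
G-pv01-5 (i), here DISCHARGED up to the two displayed geometric inputs).
[cite: Balaban1984PropagatorsII, (2.133)–(2.134) p.247, (2.90)–(2.91) p.239; derivation ours] -/
theorem localMajorant_transplant_of_window (R M : ℝ) {X : Type} [DecidableEq X] {g : B6.Geometry}
    (blk : X → g.Site) (S : Set g.Site) (pos : X → Fin (d + 1) → ℤ) (dir : X → Fin (d + 1)) (x₀ : Fin (d + 1) → ℤ)
    {Wd : ℕ} (hWd : Wd ≤ L ^ (i.m + i.K)) (W : Finset X) (hW : ∀ x ∈ W, InWindow pos x₀ Wd x)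
    (hinj : Set.InjOn (fun x => (pos x, dir x)) ↑W)
    {T' : Module.End ℝ (PBond i.P 0 → ℝ)} {A δ : ℝ} (hA : 0 ≤ A) (hδ : 0 ≤ δ)
    (hT' : HasMajorant (g := tsGeo i R M) (fun b : PBond i.P 0 => iterBlockOf i.j b.src) T'
      (fun y y' => A * Real.exp (-(δ * i.tdist y y'))))
    (κ c : ℝ) (hκ : 0 < κ)
    (hglob : ∀ x ∈ W, ∀ x₁ ∈ W, blk x ∈ S → blk x₁ ∈ S →
      g.dist (blk x) (blk x₁) ≤ κ * (supNorm (pos x - pos x₁) / ((L ^ i.j : ℕ) : ℝ)) + c)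
    (n : ℕ) (hfib : ∀ y ∈ S, ∃ T : Finset (Site i.P i.j), T.card ≤ n ∧
      ∀ x ∈ W, blk x = y → iterBlockOf i.j (chartBond i pos dir x₀ x).src ∈ T) :
    LocalMajorant blk (transplant W (chartBond i pos dir x₀) T') S
      (fun a b => n * ((A * Real.exp (δ * (κ + c) / κ)) * Real.exp (-(δ / κ * g.dist a b)))) := by
  classical
  have hL0 : 0 < L := by have := hL.2; omega
  have hnpos : (0 : ℝ) < ((L ^ i.j : ℕ) : ℝ) := by positivity
  refine localMajorant_transplant (g' := tsGeo i R M) blk (fun b : PBond i.P 0 => iterBlockOf i.j b.src) S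
    (injOn_chartBond i pos dir x₀ hWd W hW hinj) hT' _ (fun a b => ?_) (fun x hx x₁ hx₁ hxS hx₁S => ?_) n hfib
  · positivity
  · -- the comparison of the kernels from the comparison of the distances
    have hwin : ∀ {x}, x ∈ W → (∀ μ, 0 ≤ pos x μ - x₀ μ) ∧ ∀ μ, pos x μ - x₀ μ < ((L ^ (i.m + i.K) : ℕ) : ℤ) := by
      intro x hx
      refine ⟨fun μ => by have := (hW x hx μ).1; linarith, fun μ => ?_⟩
      have := (hW x hx μ).2
      have hc : ((Wd : ℕ) : ℤ) ≤ ((L ^ (i.m + i.K) : ℕ) : ℤ) := by exact_mod_cast hWd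
      linarith
    have hsup := supNorm_sub_le_tdist i (hwin hx).1 (hwin hx₁).1 (hwin hx).2 (hwin hx₁).2
    have hsub : (fun μ => pos x μ - x₀ μ) - (fun μ => pos x₁ μ - x₀ μ) = pos x - pos x₁ := by
      funext μ
      simp only [Pi.sub_apply]
      ring
    rw [hsub] at hsup
    simp only [chartBond_src]
    set t := i.tdist (iterBlockOf i.j (siteOfInt i fun μ => pos x μ - x₀ μ)) (iterBlockOf i.j (siteOfInt i fun μ => pos x₁ μ - x₀ μ))
      with ht
    have htn : 0 ≤ t := i.tdist_nonneg _ _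
    -- `|pos x − pos x₁|_∞ / L^j ≤ t + 1`
    have hdiv : supNorm (pos x - pos x₁) / ((L ^ i.j : ℕ) : ℝ) ≤ t + 1 := by
      rw [div_le_iff₀ hnpos]
      nlinarith
    have hdist : g.dist (blk x) (blk x₁) ≤ κ * t + (κ + c) := by
      have := hglob x hx x₁ hx₁ hxS hx₁S
      nlinarith [mul_le_mul_of_nonneg_left hdiv hκ.le]
    exact expKernel_le_of_dist_le hA hδ hκ hdist

/-- **(2.133) FOR THE GENUINE TWO-SCALE `G_□`, TRANSPLANTED** — ONE `δ₂ > 0`, ONE `A ≥ 0` (on `d, L, a₀, a₁`) BEFORE everything: for every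
member `i` of the two-scale family and every window chart of a global block geometry as in `localMajorant_transplant_of_window`, the
transplanted `G_□` (`transplant W (chartBond …) (onFun G_□)`, the operator meant by `G_□` inside `G₀ = Σ_□ h_□G_□h_□` of (2.91)) has the
local majorant `n·A·e^{δ₂(κ+c)/κ}·e^{−(δ₂/κ)d(y,y′)}` on the reach `S` — p38's `B6Ineq2133TwoScaleV1.ineq2133_G` through the bridge.
[cite: Balaban1984PropagatorsII, (2.133) p.247, Prop. 2.5 p.246, (2.90)–(2.91) p.239] -/
theorem reach2133_G (d L : ℕ) (hd : 1 ≤ d + 1) (hL : Odd L ∧ 1 < L) {a₀ a₁ : ℝ} (ha₀ : 0 < a₀) (ha₁ : a₀ ≤ a₁) :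
    ∃ δ : ℝ, 0 < δ ∧ ∃ A : ℝ, 0 ≤ A ∧ ∀ (i : TSIdx d L hd hL a₀ a₁) {X : Type} [DecidableEq X] {g : B6.Geometry}
      (blk : X → g.Site) (S : Set g.Site) (pos : X → Fin (d + 1) → ℤ) (dir : X → Fin (d + 1)) (x₀ : Fin (d + 1) → ℤ)
      {Wd : ℕ} (_ : Wd ≤ L ^ (i.m + i.K)) (W : Finset X) (_ : ∀ x ∈ W, InWindow pos x₀ Wd x)
      (_ : Set.InjOn (fun x => (pos x, dir x)) ↑W) (κ c : ℝ) (_ : 0 < κ)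
      (_ : ∀ x ∈ W, ∀ x₁ ∈ W, blk x ∈ S → blk x₁ ∈ S →
        g.dist (blk x) (blk x₁) ≤ κ * (supNorm (pos x - pos x₁) / ((L ^ i.j : ℕ) : ℝ)) + c)
      (n : ℕ) (_ : ∀ y ∈ S, ∃ T : Finset (Site i.P i.j), T.card ≤ n ∧
        ∀ x ∈ W, blk x = y → iterBlockOf i.j (chartBond i pos dir x₀ x).src ∈ T),
      LocalMajorant blk (transplant W (chartBond i pos dir x₀) (onFun i.D.G)) S
        (fun a b => n * ((A * Real.exp (δ * (κ + c) / κ)) * Real.exp (-(δ / κ * g.dist a b)))) := by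
  obtain ⟨δ, hδ, A, hA, h⟩ := ineq2133_G d L hd hL ha₀ ha₁
  exact ⟨δ, hδ, A, hA, fun i X _ g blk S pos dir x₀ Wd hWd W hW hinj κ c hκ hglob n hfib =>
    localMajorant_transplant_of_window i 0 0 blk S pos dir x₀ hWd W hW hinj hA hδ.le (h i 0 0) κ c hκ hglob n hfib⟩

/-- the same for `∇_λG_□` (the second entry of (2.133)), every direction `λ` — p38's `ineq2133_DG` through the bridge.
[cite: Balaban1984PropagatorsII, (2.133) p.247, Prop. 2.5 p.246] -/
theorem reach2133_DG (d L : ℕ) (hd : 1 ≤ d + 1) (hL : Odd L ∧ 1 < L) {a₀ a₁ : ℝ} (ha₀ : 0 < a₀) (ha₁ : a₀ ≤ a₁) :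
    ∃ δ : ℝ, 0 < δ ∧ ∃ A : ℝ, 0 ≤ A ∧ ∀ (i : TSIdx d L hd hL a₀ a₁) (lam : Fin i.P.d) {X : Type} [DecidableEq X] {g : B6.Geometry}
      (blk : X → g.Site) (S : Set g.Site) (pos : X → Fin (d + 1) → ℤ) (dir : X → Fin (d + 1)) (x₀ : Fin (d + 1) → ℤ)
      {Wd : ℕ} (_ : Wd ≤ L ^ (i.m + i.K)) (W : Finset X) (_ : ∀ x ∈ W, InWindow pos x₀ Wd x)
      (_ : Set.InjOn (fun x => (pos x, dir x)) ↑W) (κ c : ℝ) (_ : 0 < κ)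
      (_ : ∀ x ∈ W, ∀ x₁ ∈ W, blk x ∈ S → blk x₁ ∈ S →
        g.dist (blk x) (blk x₁) ≤ κ * (supNorm (pos x - pos x₁) / ((L ^ i.j : ℕ) : ℝ)) + c)
      (n : ℕ) (_ : ∀ y ∈ S, ∃ T : Finset (Site i.P i.j), T.card ≤ n ∧
        ∀ x ∈ W, blk x = y → iterBlockOf i.j (chartBond i pos dir x₀ x).src ∈ T),
      LocalMajorant blk (transplant W (chartBond i pos dir x₀) (onFun (i.Dl lam ∘ₗ i.D.G))) S
        (fun a b => n * ((A * Real.exp (δ * (κ + c) / κ)) * Real.exp (-(δ / κ * g.dist a b)))) := by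
  obtain ⟨δ, hδ, A, hA, h⟩ := ineq2133_DG d L hd hL ha₀ ha₁
  exact ⟨δ, hδ, A, hA, fun i lam X _ g blk S pos dir x₀ Wd hWd W hW hinj κ c hκ hglob n hfib =>
    localMajorant_transplant_of_window i 0 0 blk S pos dir x₀ hWd W hW hinj hA hδ.le (h i 0 0 lam) κ c hκ hglob n hfib⟩

end Bridge

/-! ## §5  The bridge FIRED on the genuine nested box family of `B6Geom246MultiLevelBox` (p21): the two geometric inputs — the
distance comparison (`dist_blkOf_le_box`, `κ = c = d + 1`) and the fibre count (`≤ L^{d+1}` charted `j`-blocks over a block of level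
`j` or `j + 1`) — DISCHARGED for a window of levels `j, j + 1` with corner in `L^jℤ^{d+1}` -/

section BoxFamily

open B4Reflection242 (boxDom mem_boxDom)
open B4ContourShift (supNorm supNorm_nonneg)
open B5Eq118OneStroke (iterBlockOf)
open B6LowerBound2153Torus (rep)
open B5Eq117TorusCarriers (Mk)
open B6MultiLevelBoxOperator (Domains N0)
open B6Geom246MultiLevelBox (bset blkOf geom bond dist_blkOf_le_box coord_bounds lev_eq_of_blkOf_eq)
open B6Prop25TwoScaleCensus (TSIdx)
open B6Ineq2133TwoScaleV1 (tsGeo onFun ineq2133_G ineq2133_DG)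

variable {d ℓ : ℕ} {hd : 1 ≤ d + 1} {hL : Odd (ℓ + 1) ∧ 1 < ℓ + 1} {a₀ a₁ : ℝ} (i : TSIdx d (ℓ + 1) hd hL a₀ a₁)
variable {Mh k R : ℕ} {P : Fin (d + 1) → ℕ} (D : Domains d ℓ Mh k P R)

/-- **THE GLOBAL BONDS** of the fine box `X = Π_μ[0, N₀_μ)` of the nested family: pairs (initial point, direction) — print's «Ω also
the set of bonds ⋃_{x∈Ω} st(x)» (p. 224). [cite: Balaban1984PropagatorsII, p.224, dictionary] -/
abbrev BoxBond (ℓ Mh k : ℕ) (P : Fin (d + 1) → ℕ) : Type := ↥(boxDom (N0 ℓ Mh k P)) × Fin (d + 1)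

/-- the block map of the bonds: `b ↦ y(b₋)` (the block of the initial point, as p38's `fun b => iterBlockOf j b.src` on `T_□`).
[cite: Balaban1984PropagatorsII, (2.133) p.247 («x ∈ Δ(y)»), p.231 («d(x, x′) = d(y, y′) if x ∈ B^j(y)»), dictionary] -/
def blkBond (b : BoxBond ℓ Mh k P) : ↥(bset D) := blkOf D b.1

/-- `(pos, dir)` is injective on bonds (a bond IS its initial point and direction). [folklore] -/
private theorem injOn_pos_dir (W : Finset (BoxBond ℓ Mh k P)) :
    Set.InjOn (fun b : BoxBond ℓ Mh k P => ((b.1 : Fin (d + 1) → ℤ), b.2)) ↑W := by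
  intro b _ b' _ h
  simp only [Prod.mk.injEq] at h
  exact Prod.ext (Subtype.ext h.1) h.2

/-- `rep` is injective: a site of `T^{(j)}` is determined by its labels. [folklore] -/
private theorem rep_injective : Function.Injective (rep (Mk i.P i.j) : Site i.P i.j → Fin (d + 1) → ℤ) := by
  intro y y' h
  funext μ
  have hμ := congrFun h μ
  simp only [rep, Nat.cast_inj] at hμ
  exact ZMod.val_injective _ hμ

/-- **THE DISTANCE INPUT ON THE BOX FAMILY**: for bonds of a window all of whose sites have level `≥ j`, `d(y(b₋), y(b′₋)) ≤
(d+1)·|b₋ − b′₋|_∞/L^j + (d+1)` — p21's `B6Geom246MultiLevelBox.dist_blkOf_le_box` (the comparison used on p. 232 to read cube estimates in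
the form (2.53)), the window being coordinatewise convex. [cite: Balaban1984PropagatorsII, p.232 (before (2.53)), (2.46) p.231] -/
theorem hglob_box (hMh : 1 ≤ Mh) (hP : ∀ μ, 1 ≤ P μ) (x₀ : Fin (d + 1) → ℤ) (Wd : ℕ)
    (hlev : ∀ z ∈ boxDom (N0 ℓ Mh k P), (∀ μ, x₀ μ ≤ z μ ∧ z μ < x₀ μ + Wd) → i.j ≤ D.lev z)
    (W : Finset (BoxBond ℓ Mh k P)) (hW : ∀ b ∈ W, InWindow (fun b : BoxBond ℓ Mh k P => (b.1 : Fin (d + 1) → ℤ)) x₀ Wd b)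
    (S : Set (geom D).Site) :
    ∀ b ∈ W, ∀ b₁ ∈ W, blkBond D b ∈ S → blkBond D b₁ ∈ S →
      (geom D).dist (blkBond D b) (blkBond D b₁) ≤
        (d + 1 : ℝ) * (supNorm ((b.1 : Fin (d + 1) → ℤ) - (b₁.1 : Fin (d + 1) → ℤ)) / (((ℓ + 1) ^ i.j : ℕ) : ℝ)) + (d + 1 : ℝ) := by
  intro b hb b₁ hb₁ _ _
  have h := dist_blkOf_le_box (D := D) hMh hP b.1 b₁.1 (i := i.j) fun z hz hbox => hlev z hz fun μ => by
    obtain ⟨hlo, hhi⟩ := hbox μ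
    have h1 := hW b hb μ
    have h2 := hW b₁ hb₁ μ
    constructor
    · exact le_trans (le_min h1.1 h2.1) hlo
    · exact lt_of_le_of_lt hhi (max_lt h1.2 h2.2)
  show (((bond D).dist (blkOf D b.1) (blkOf D b₁.1) : ℕ) : ℝ) ≤ _
  linarith

/-- **THE FIBRE INPUT ON THE BOX FAMILY**: over a global block of level `j` or `j + 1` meeting the window (corner `x₀ ∈ L^jℤ^{d+1}`)
there are at most `L^{d+1}` charted `j`-blocks of `T_□` (a block of level `j + 1` IS a cube of `L^{d+1}` blocks of level `j`; one of
level `j` is charted onto one block). [cite: Balaban1984PropagatorsII, (2.1) p.224 («B^j(Ω_j^{(j)})»), (2.89) p.239; Balaban1984PropagatorsI, (1.16)–(1.18) p.20] -/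
theorem hfib_box (x₀ : Fin (d + 1) → ℤ) (hx₀ : ∀ μ, (((ℓ + 1) ^ i.j : ℕ) : ℤ) ∣ x₀ μ) (Wd : ℕ) (hWd : Wd ≤ (ℓ + 1) ^ (i.m + i.K))
    (hlev : ∀ z ∈ boxDom (N0 ℓ Mh k P), (∀ μ, x₀ μ ≤ z μ ∧ z μ < x₀ μ + Wd) → i.j ≤ D.lev z ∧ D.lev z ≤ i.j + 1)
    (W : Finset (BoxBond ℓ Mh k P)) (hW : ∀ b ∈ W, InWindow (fun b : BoxBond ℓ Mh k P => (b.1 : Fin (d + 1) → ℤ)) x₀ Wd b)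
    (y : (geom D).Site) :
    ∃ T : Finset (Site i.P i.j), T.card ≤ (ℓ + 1) ^ (d + 1) ∧ ∀ b ∈ W, blkBond D b = y → iterBlockOf i.j
      (chartBond i (fun b : BoxBond ℓ Mh k P => (b.1 : Fin (d + 1) → ℤ)) (fun b => b.2) x₀ b).src ∈ T := by
  classical
  set F := (W.filter (fun b => blkBond D b = y)).image (fun b => iterBlockOf i.j
      (chartBond i (fun b : BoxBond ℓ Mh k P => (b.1 : Fin (d + 1) → ℤ)) (fun b => b.2) x₀ b).src) with hF
  have hmemF : ∀ b ∈ W, blkBond D b = y → iterBlockOf i.j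
      (chartBond i (fun b : BoxBond ℓ Mh k P => (b.1 : Fin (d + 1) → ℤ)) (fun b => b.2) x₀ b).src ∈ F := fun b hb hby =>
    Finset.mem_image.mpr ⟨b, Finset.mem_filter.mpr ⟨hb, hby⟩, rfl⟩
  refine ⟨F, ?_, hmemF⟩
  by_cases hne : (W.filter (fun b => blkBond D b = y)) = ∅
  · rw [hF, hne, Finset.image_empty, Finset.card_empty]
    exact Nat.zero_le _
  obtain ⟨b₀, hb₀⟩ := Finset.nonempty_iff_ne_empty.mpr hne
  obtain ⟨hb₀W, hb₀y⟩ := Finset.mem_filter.mp hb₀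
  -- the level `t` of the block `y` and its range
  set t := y.1.1 with ht
  have hwin₀ := hW b₀ hb₀W
  have htlev : D.lev (b₀.1 : Fin (d + 1) → ℤ) = t := lev_eq_of_blkOf_eq D hb₀y
  have ht_range : i.j ≤ t ∧ t ≤ i.j + 1 := by
    rw [← htlev]
    exact hlev _ b₀.1.2 hwin₀
  have hL1 : 1 ≤ ℓ + 1 := by omega
  have hLpos : (0 : ℤ) < (((ℓ + 1) ^ i.j : ℕ) : ℤ) := by positivity
  -- the divisibility `L^j ∣ L^t·y_μ − x₀_μ`
  have hdvd : ∀ μ, (((ℓ + 1) ^ i.j : ℕ) : ℤ) ∣ (((ℓ + 1) ^ t : ℕ) : ℤ) * y.1.2 μ - x₀ μ := fun μ =>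
    dvd_sub (dvd_mul_of_dvd_left (by exact_mod_cast pow_dvd_pow (ℓ + 1) ht_range.1) _) (hx₀ μ)
  -- the label box
  set a : Fin (d + 1) → ℤ := fun μ => ((((ℓ + 1) ^ t : ℕ) : ℤ) * y.1.2 μ - x₀ μ) / (((ℓ + 1) ^ i.j : ℕ) : ℤ) with ha
  set B : Finset (Fin (d + 1) → ℤ) := Fintype.piFinset fun μ => Finset.Ico (a μ) (a μ + (ℓ + 1 : ℕ)) with hB
  have hBcard : B.card = (ℓ + 1) ^ (d + 1) := by
    rw [hB, Fintype.card_piFinset]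
    simp only [Int.card_Ico, add_sub_cancel_left, Int.toNat_natCast, Finset.prod_const, Finset.card_univ,
      Fintype.card_fin]
  -- every charted block of the fibre has its labels in the box
  have hinto : ∀ s ∈ F, rep (Mk i.P i.j) s ∈ B := by
    intro s hs
    obtain ⟨b, hb, rfl⟩ := Finset.mem_image.mp hs
    obtain ⟨hbW, hby⟩ := Finset.mem_filter.mp hb
    have hwin := hW b hbW
    have hz0 : ∀ μ, 0 ≤ (b.1 : Fin (d + 1) → ℤ) μ - x₀ μ := fun μ => by have := (hwin μ).1; linarith
    have hzN : ∀ μ, (b.1 : Fin (d + 1) → ℤ) μ - x₀ μ < (i.P.sitesPerDir 0 : ℕ) := fun μ => by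
      refine lt_sitesPerDir_of_window i ?_
      have := (hwin μ).2
      have hc : ((Wd : ℕ) : ℤ) ≤ (((ℓ + 1) ^ (i.m + i.K) : ℕ) : ℤ) := by exact_mod_cast hWd
      linarith
    rw [hB, Fintype.mem_piFinset]
    intro μ
    rw [Finset.mem_Ico, chartBond_src, rep_iterBlockOf_siteOfInt i hz0 hzN μ]
    obtain ⟨hlo, hhi⟩ := coord_bounds D hby μ
    have hlo' : (((ℓ + 1) ^ t : ℕ) : ℤ) * y.1.2 μ - x₀ μ ≤ (b.1 : Fin (d + 1) → ℤ) μ - x₀ μ := by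
      have : (((ℓ + 1) ^ y.1.1 : ℕ) : ℤ) = (((ℓ + 1) ^ t : ℕ) : ℤ) := by rw [ht]
      linarith
    constructor
    · exact Int.ediv_le_ediv hLpos hlo'
    · -- `(b_μ − x₀_μ) < (a_μ + L)·L^j`
      refine Int.ediv_lt_of_lt_mul hLpos ?_
      have hmul : a μ * (((ℓ + 1) ^ i.j : ℕ) : ℤ) = (((ℓ + 1) ^ t : ℕ) : ℤ) * y.1.2 μ - x₀ μ :=
        Int.ediv_mul_cancel (hdvd μ)
      have hpow : (((ℓ + 1) ^ t : ℕ) : ℤ) ≤ ((ℓ + 1 : ℕ) : ℤ) * (((ℓ + 1) ^ i.j : ℕ) : ℤ) := by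
        rw [← Nat.cast_mul, ← pow_succ']
        exact_mod_cast Nat.pow_le_pow_right hL1 ht_range.2
      have hhi' : (b.1 : Fin (d + 1) → ℤ) μ < (((ℓ + 1) ^ t : ℕ) : ℤ) * y.1.2 μ + (((ℓ + 1) ^ t : ℕ) : ℤ) := by
        have : (((ℓ + 1) ^ y.1.1 : ℕ) : ℤ) = (((ℓ + 1) ^ t : ℕ) : ℤ) := by rw [ht]
        linarith
      nlinarith
  calc F.card ≤ B.card := Finset.card_le_card_of_injOn (rep (Mk i.P i.j)) hinto ((rep_injective i).injOn)
    _ = (ℓ + 1) ^ (d + 1) := hBcard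

/-- **(2.133) ⟹ `h2133` ON THE GENUINE NESTED BOX FAMILY** (B6-CLOSURE §5 item 6 (c), the geometry bridge, FIRED): ONE `δ₂ > 0`, ONE
`A ≥ 0` (on `d, L, a₀, a₁`) such that for every member `G_□` of the two-scale family (census index `TSIdx`), every nested box family `D`
(`B6MultiLevelBoxOperator.Domains`, `M_h ≥ 1`, `P_μ ≥ 1`), every window (corner `x₀ ∈ L^jℤ^{d+1}`, side `W ≤ L^{m+K}`, all of whose
box sites have level `j` or `j + 1` — the two-level window of a cube «connected with the L^jη-scale», p. 238), every finite set `W`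
of bonds of the window and every reach `S ⊂ 𝔅`: the transplanted `G_□` has the LOCAL MAJORANT
`L^{d+1}·A·e^{2δ₂}·e^{−(δ₂/(d+1))·d(y,y′)}` on `S` for the geometry `geom D` (distance (2.46), reading R2) and the block map
`b ↦ y(b₋)` — literally the hypothesis `h2133` of `B6Prop26Gluing.prop26_2136_of_2133_2134_lemma21` (with `P ≡ 1`, rate `δ₂/(d+1)`
in place of print's `½δ₂`).  HONEST SCOPE in the module docstring. [cite: Balaban1984PropagatorsII, (2.133) p.247, (2.90)–(2.91) p.239, Prop. 2.5 p.246, Prop. 2.6 p.247] -/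
theorem reach2133_G_box (d ℓ : ℕ) (hd : 1 ≤ d + 1) (hL : Odd (ℓ + 1) ∧ 1 < ℓ + 1) {a₀ a₁ : ℝ} (ha₀ : 0 < a₀) (ha₁ : a₀ ≤ a₁) :
    ∃ δ : ℝ, 0 < δ ∧ ∃ A : ℝ, 0 ≤ A ∧ ∀ (i : TSIdx d (ℓ + 1) hd hL a₀ a₁) {Mh k R : ℕ} {P : Fin (d + 1) → ℕ}
      (D : Domains d ℓ Mh k P R) (_ : 1 ≤ Mh) (_ : ∀ μ, 1 ≤ P μ) (x₀ : Fin (d + 1) → ℤ)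
      (_ : ∀ μ, (((ℓ + 1) ^ i.j : ℕ) : ℤ) ∣ x₀ μ) (Wd : ℕ) (_ : Wd ≤ (ℓ + 1) ^ (i.m + i.K))
      (_ : ∀ z ∈ boxDom (N0 ℓ Mh k P), (∀ μ, x₀ μ ≤ z μ ∧ z μ < x₀ μ + Wd) → i.j ≤ D.lev z ∧ D.lev z ≤ i.j + 1)
      (W : Finset (BoxBond ℓ Mh k P)) (_ : ∀ b ∈ W, InWindow (fun b : BoxBond ℓ Mh k P => (b.1 : Fin (d + 1) → ℤ)) x₀ Wd b)
      (S : Set (geom D).Site),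
      LocalMajorant (g := geom D) (blkBond D)
        (transplant W (chartBond i (fun b : BoxBond ℓ Mh k P => (b.1 : Fin (d + 1) → ℤ)) (fun b => b.2) x₀) (onFun i.D.G)) S
        (fun a b => ((ℓ + 1) ^ (d + 1) : ℕ) * ((A * Real.exp (δ * ((d + 1 : ℝ) + (d + 1)) / (d + 1))) *
          Real.exp (-(δ / (d + 1) * (geom D).dist a b)))) := by
  obtain ⟨δ, hδ, A, hA, h⟩ := reach2133_G d (ℓ + 1) hd hL ha₀ ha₁
  refine ⟨δ, hδ, A, hA, fun i Mh k R P D hMh hP x₀ hx₀ Wd hWd hlev W hW S => ?_⟩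
  classical
  exact h i (blkBond D) S (fun b : BoxBond ℓ Mh k P => (b.1 : Fin (d + 1) → ℤ)) (fun b => b.2) x₀ hWd W hW (injOn_pos_dir W)
    (d + 1) (d + 1) (by positivity) (hglob_box i D hMh hP x₀ Wd (fun z hz hw => (hlev z hz hw).1) W hW S) ((ℓ + 1) ^ (d + 1))
    (fun y _ => hfib_box i D x₀ hx₀ Wd hWd hlev W hW y)

/-- the `∇_λG_□` twin of `reach2133_G_box` (second entry of (2.133)), every direction `λ`. [cite: Balaban1984PropagatorsII, (2.133) p.247, Prop. 2.5 p.246] -/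
theorem reach2133_DG_box (d ℓ : ℕ) (hd : 1 ≤ d + 1) (hL : Odd (ℓ + 1) ∧ 1 < ℓ + 1) {a₀ a₁ : ℝ} (ha₀ : 0 < a₀) (ha₁ : a₀ ≤ a₁) :
    ∃ δ : ℝ, 0 < δ ∧ ∃ A : ℝ, 0 ≤ A ∧ ∀ (i : TSIdx d (ℓ + 1) hd hL a₀ a₁) (lam : Fin i.P.d) {Mh k R : ℕ} {P : Fin (d + 1) → ℕ}
      (D : Domains d ℓ Mh k P R) (_ : 1 ≤ Mh) (_ : ∀ μ, 1 ≤ P μ) (x₀ : Fin (d + 1) → ℤ)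
      (_ : ∀ μ, (((ℓ + 1) ^ i.j : ℕ) : ℤ) ∣ x₀ μ) (Wd : ℕ) (_ : Wd ≤ (ℓ + 1) ^ (i.m + i.K))
      (_ : ∀ z ∈ boxDom (N0 ℓ Mh k P), (∀ μ, x₀ μ ≤ z μ ∧ z μ < x₀ μ + Wd) → i.j ≤ D.lev z ∧ D.lev z ≤ i.j + 1)
      (W : Finset (BoxBond ℓ Mh k P)) (_ : ∀ b ∈ W, InWindow (fun b : BoxBond ℓ Mh k P => (b.1 : Fin (d + 1) → ℤ)) x₀ Wd b)
      (S : Set (geom D).Site),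
      LocalMajorant (g := geom D) (blkBond D)
        (transplant W (chartBond i (fun b : BoxBond ℓ Mh k P => (b.1 : Fin (d + 1) → ℤ)) (fun b => b.2) x₀)
          (onFun (i.Dl lam ∘ₗ i.D.G))) S
        (fun a b => ((ℓ + 1) ^ (d + 1) : ℕ) * ((A * Real.exp (δ * ((d + 1 : ℝ) + (d + 1)) / (d + 1))) *
          Real.exp (-(δ / (d + 1) * (geom D).dist a b)))) := by
  obtain ⟨δ, hδ, A, hA, h⟩ := reach2133_DG d (ℓ + 1) hd hL ha₀ ha₁
  refine ⟨δ, hδ, A, hA, fun i lam Mh k R P D hMh hP x₀ hx₀ Wd hWd hlev W hW S => ?_⟩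
  classical
  exact h i lam (blkBond D) S (fun b : BoxBond ℓ Mh k P => (b.1 : Fin (d + 1) → ℤ)) (fun b => b.2) x₀ hWd W hW (injOn_pos_dir W)
    (d + 1) (d + 1) (by positivity) (hglob_box i D hMh hP x₀ Wd (fun z hz hw => (hlev z hz hw).1) W hW S) ((ℓ + 1) ^ (d + 1))
    (fun y _ => hfib_box i D x₀ hx₀ Wd hWd hlev W hW y)

end BoxFamily

/-! ## §6  The same on print's own carrier `T_η` (p21's torus family `TDomains`, geometry `geomT`): a window of the fundamental box
(not wrapping around `T_η`; wrapping windows go through the translation charts of `B6Geom246MultiLevelTorus.distT_le_dist_chart`) -/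

section TorusFamily

open B4Reflection242 (boxDom)
open B4ContourShift (supNorm)
open B5Eq118OneStroke (iterBlockOf)
open B6MultiLevelBoxOperator (Domains N0)
open B6MultiLevelTorusOperator (TDomains)
open B6Geom246MultiLevelBox (bset blkOf geom bond)
open B6Geom246MultiLevelTorus (geomT bondT distT_le_dist_box)
open B6Prop25TwoScaleCensus (TSIdx)
open B6Ineq2133TwoScaleV1 (onFun)

variable {d ℓ : ℕ} {hd : 1 ≤ d + 1} {hL : Odd (ℓ + 1) ∧ 1 < ℓ + 1} {a₀ a₁ : ℝ} (i : TSIdx d (ℓ + 1) hd hL a₀ a₁)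
variable {Mh k R : ℕ} {P : Fin (d + 1) → ℕ} (D : TDomains d ℓ Mh k P R)

/-- **THE DISTANCE INPUT ON THE TORUS FAMILY**: `d_T ≤ d_box` on the same blocks (`distT_le_dist_box`: every bond of the fundamental box
is a bond of the torus), so the box comparison `hglob_box` for `D.toDomains` is a comparison for `geomT D`.
[cite: Balaban1984PropagatorsII, (2.46) p.231, p.224 («Ω_j ⊂ T_η»)] -/
theorem hglob_torus (hMh : 1 ≤ Mh) (hP : ∀ μ, 1 ≤ P μ) (x₀ : Fin (d + 1) → ℤ) (Wd : ℕ)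
    (hlev : ∀ z ∈ boxDom (N0 ℓ Mh k P), (∀ μ, x₀ μ ≤ z μ ∧ z μ < x₀ μ + Wd) → i.j ≤ D.lev z)
    (W : Finset (BoxBond ℓ Mh k P)) (hW : ∀ b ∈ W, InWindow (fun b : BoxBond ℓ Mh k P => (b.1 : Fin (d + 1) → ℤ)) x₀ Wd b)
    (S : Set (geomT D).Site) :
    ∀ b ∈ W, ∀ b₁ ∈ W, blkBond D.toDomains b ∈ S → blkBond D.toDomains b₁ ∈ S →
      (geomT D).dist (blkBond D.toDomains b) (blkBond D.toDomains b₁) ≤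
        (d + 1 : ℝ) * (supNorm ((b.1 : Fin (d + 1) → ℤ) - (b₁.1 : Fin (d + 1) → ℤ)) / (((ℓ + 1) ^ i.j : ℕ) : ℝ)) + (d + 1 : ℝ) := by
  intro b hb b₁ hb₁ _ _
  have hbox := hglob_box i D.toDomains hMh hP x₀ Wd hlev W hW Set.univ b hb b₁ hb₁ (Set.mem_univ _) (Set.mem_univ _)
  have hT : (((bondT D).dist (blkBond D.toDomains b) (blkBond D.toDomains b₁) : ℕ) : ℝ)
      ≤ (((bond D.toDomains).dist (blkBond D.toDomains b) (blkBond D.toDomains b₁) : ℕ) : ℝ) := by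
    exact_mod_cast distT_le_dist_box (D := D) hMh hP _ _
  exact hT.trans hbox

/-- **(2.133) ⟹ `h2133` ON THE GENUINE NESTED TORUS FAMILY `T_η`** (print's carrier, p21's `TDomains`/`geomT`, distance (2.46) with bonds
across the torus): as `reach2133_G_box`, for windows of the fundamental box, with the majorant in `d_T`.
[cite: Balaban1984PropagatorsII, (2.133) p.247, (2.90)–(2.91) p.239, Prop. 2.6 p.247, p.224 («Ω_j ⊂ T_η»)] -/
theorem reach2133_G_torus (d ℓ : ℕ) (hd : 1 ≤ d + 1) (hL : Odd (ℓ + 1) ∧ 1 < ℓ + 1) {a₀ a₁ : ℝ} (ha₀ : 0 < a₀) (ha₁ : a₀ ≤ a₁) :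
    ∃ δ : ℝ, 0 < δ ∧ ∃ A : ℝ, 0 ≤ A ∧ ∀ (i : TSIdx d (ℓ + 1) hd hL a₀ a₁) {Mh k R : ℕ} {P : Fin (d + 1) → ℕ}
      (D : TDomains d ℓ Mh k P R) (_ : 1 ≤ Mh) (_ : ∀ μ, 1 ≤ P μ) (x₀ : Fin (d + 1) → ℤ)
      (_ : ∀ μ, (((ℓ + 1) ^ i.j : ℕ) : ℤ) ∣ x₀ μ) (Wd : ℕ) (_ : Wd ≤ (ℓ + 1) ^ (i.m + i.K))
      (_ : ∀ z ∈ boxDom (N0 ℓ Mh k P), (∀ μ, x₀ μ ≤ z μ ∧ z μ < x₀ μ + Wd) → i.j ≤ D.lev z ∧ D.lev z ≤ i.j + 1)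
      (W : Finset (BoxBond ℓ Mh k P)) (_ : ∀ b ∈ W, InWindow (fun b : BoxBond ℓ Mh k P => (b.1 : Fin (d + 1) → ℤ)) x₀ Wd b)
      (S : Set (geomT D).Site),
      LocalMajorant (g := geomT D) (blkBond D.toDomains)
        (transplant W (chartBond i (fun b : BoxBond ℓ Mh k P => (b.1 : Fin (d + 1) → ℤ)) (fun b => b.2) x₀) (onFun i.D.G)) S
        (fun a b => ((ℓ + 1) ^ (d + 1) : ℕ) * ((A * Real.exp (δ * ((d + 1 : ℝ) + (d + 1)) / (d + 1))) *
          Real.exp (-(δ / (d + 1) * (geomT D).dist a b)))) := by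
  obtain ⟨δ, hδ, A, hA, h⟩ := reach2133_G d (ℓ + 1) hd hL ha₀ ha₁
  refine ⟨δ, hδ, A, hA, fun i Mh k R P D hMh hP x₀ hx₀ Wd hWd hlev W hW S => ?_⟩
  classical
  exact h i (blkBond D.toDomains) S (fun b : BoxBond ℓ Mh k P => (b.1 : Fin (d + 1) → ℤ)) (fun b => b.2) x₀ hWd W hW
    (injOn_pos_dir W) (d + 1) (d + 1) (by positivity)
    (hglob_torus i D hMh hP x₀ Wd (fun z hz hw => (hlev z hz hw).1) W hW S) ((ℓ + 1) ^ (d + 1))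
    (fun y _ => hfib_box i D.toDomains x₀ hx₀ Wd hWd hlev W hW y)

end TorusFamily

/-! ## §7  (v1.1) The same ON THE CARRIERS OF THE (2.134) FILES (p38's `B6Ineq2134ThetaKLevel`: member `i : KIdx d ℓ`, geometry
`geoB i` in print's units, bonds `XV i = Fin (d+1) × ↥i.XB`, block map `blkV i`), IN PRINT'S `η`-UNITS: `G_□^η = (L^jη)²·G_□^ξ` (2.94), so the
majorant carries the weight `(L^jη)² ≤ len(y″)²` — EXACTLY the hypothesis `hG` of `B6Ineq2134ThetaKLevel.ineq2134_kOff_kLevel` -/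

section GeoB

open B4Reflection242 (boxDom mem_boxDom)
open B4ContourShift (supNorm supNorm_nonneg)
open B5Eq118OneStroke (iterBlockOf)
open B6LowerBound2153Torus (rep)
open B5Eq117TorusCarriers (Mk)
open B6MultiLevelBoxOperator (Domains N0)
open B6Geom246MultiLevelBox (bset blkOf geom bond dist_blkOf_le_box coord_bounds lev_eq_of_blkOf_eq)
open B6Prop25TwoScaleCensus (TSIdx)
open B6Ineq2133TwoScaleV1 (tsGeo onFun ineq2133_G ineq2133_DG)
open B6Prop22KLevelCensus (KIdx)
open B6Prop22KLevelCensusEta (nK)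
open B6Ineq288MultiLevelBox (geoB geoB_dist geoB_len)
open B6Ineq2134ThetaKLevel (XV blkV)

variable {d ℓ : ℕ} {hd : 1 ≤ d + 1} {hL : Odd (ℓ + 1) ∧ 1 < ℓ + 1} {a₀ a₁ : ℝ} (t : TSIdx d (ℓ + 1) hd hL a₀ a₁)

/-- a local majorant scales with the operator and may be enlarged on the reach: `LocalMajorant blk T S K`, `0 ≤ c`, `c·K ≤ K′` on `S × S`
give `LocalMajorant blk (c • T) S K′` (used for the `(L^jη)²` of (2.94)). [cite: Balaban1984PropagatorsII, (2.94) p.239, (2.133) p.247; derivation ours] -/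
theorem localMajorant_smul_of_le {g : B6.Geometry} {X : Type} (blk : X → g.Site) {T : Module.End ℝ (X → ℝ)} {S : Set g.Site}
    {K K' : g.Site → g.Site → ℝ} (h : LocalMajorant blk T S K) {c : ℝ} (hc : 0 ≤ c)
    (hle : ∀ a ∈ S, ∀ b ∈ S, c * K a b ≤ K' a b) : LocalMajorant blk (c • T) S K' := by
  intro y' hy' μ B hμ x hxS
  rw [LinearMap.smul_apply, Pi.smul_apply, smul_eq_mul, abs_mul, abs_of_nonneg hc]
  calc c * |T μ x| ≤ c * (K (blk x) y' * B) := mul_le_mul_of_nonneg_left (h y' hy' μ B hμ x hxS) hc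
    _ = c * K (blk x) y' * B := by ring
    _ ≤ K' (blk x) y' * B := mul_le_mul_of_nonneg_right (hle _ hxS _ hy') hμ.nonneg

variable {Mh k R : ℕ} {P : Fin (d + 1) → ℕ} (D : Domains d ℓ Mh k P R)

/-- **THE DISTANCE INPUT for any global lattice over the box sites** (`site : X → X_box`; e.g. p38's `XV i`, `site = Prod.snd`): p21's
`dist_blkOf_le_box` on a coordinatewise convex window of levels `≥ j`. [cite: Balaban1984PropagatorsII, p.232 (before (2.53)), (2.46) p.231] -/
theorem hglob_sites (hMh : 1 ≤ Mh) (hP : ∀ μ, 1 ≤ P μ) {X : Type} (site : X → ↥(boxDom (N0 ℓ Mh k P))) (x₀ : Fin (d + 1) → ℤ)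
    (Wd : ℕ) (hlev : ∀ z ∈ boxDom (N0 ℓ Mh k P), (∀ μ, x₀ μ ≤ z μ ∧ z μ < x₀ μ + Wd) → t.j ≤ D.lev z)
    (W : Finset X) (hW : ∀ x ∈ W, InWindow (fun x => (site x : Fin (d + 1) → ℤ)) x₀ Wd x) (S : Set ↥(bset D)) :
    ∀ x ∈ W, ∀ x₁ ∈ W, blkOf D (site x) ∈ S → blkOf D (site x₁) ∈ S →
      (geom D).dist (blkOf D (site x)) (blkOf D (site x₁)) ≤
        (d + 1 : ℝ) * (supNorm ((site x : Fin (d + 1) → ℤ) - (site x₁ : Fin (d + 1) → ℤ)) / (((ℓ + 1) ^ t.j : ℕ) : ℝ)) + (d + 1 : ℝ) := by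
  intro x hx x₁ hx₁ _ _
  have h := dist_blkOf_le_box (D := D) hMh hP (site x) (site x₁) (i := t.j) fun z hz hbox => hlev z hz fun μ => by
    obtain ⟨hlo, hhi⟩ := hbox μ
    have h1 := hW x hx μ
    have h2 := hW x₁ hx₁ μ
    constructor
    · exact le_trans (le_min h1.1 h2.1) hlo
    · exact lt_of_le_of_lt hhi (max_lt h1.2 h2.2)
  show (((bond D).dist (blkOf D (site x)) (blkOf D (site x₁)) : ℕ) : ℝ) ≤ _
  linarith

/-- **THE FIBRE INPUT for any global lattice over the box sites**: `≤ L^{d+1}` charted `j`-blocks over a global block of level `j` or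
`j + 1` meeting the window (corner in `L^jℤ^{d+1}`). [cite: Balaban1984PropagatorsII, (2.1) p.224, (2.89) p.239; Balaban1984PropagatorsI, (1.16)–(1.18) p.20] -/
theorem hfib_sites {X : Type} (site : X → ↥(boxDom (N0 ℓ Mh k P))) (dir : X → Fin (d + 1)) (x₀ : Fin (d + 1) → ℤ)
    (hx₀ : ∀ μ, (((ℓ + 1) ^ t.j : ℕ) : ℤ) ∣ x₀ μ) (Wd : ℕ) (hWd : Wd ≤ (ℓ + 1) ^ (t.m + t.K))
    (hlev : ∀ z ∈ boxDom (N0 ℓ Mh k P), (∀ μ, x₀ μ ≤ z μ ∧ z μ < x₀ μ + Wd) → t.j ≤ D.lev z ∧ D.lev z ≤ t.j + 1)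
    (W : Finset X) (hW : ∀ x ∈ W, InWindow (fun x => (site x : Fin (d + 1) → ℤ)) x₀ Wd x) (y : ↥(bset D)) :
    ∃ T : Finset (Site t.P t.j), T.card ≤ (ℓ + 1) ^ (d + 1) ∧ ∀ x ∈ W, blkOf D (site x) = y → iterBlockOf t.j
      (chartBond t (fun x => (site x : Fin (d + 1) → ℤ)) dir x₀ x).src ∈ T := by
  classical
  set F := (W.filter (fun x => blkOf D (site x) = y)).image (fun x => iterBlockOf t.j
      (chartBond t (fun x => (site x : Fin (d + 1) → ℤ)) dir x₀ x).src) with hF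
  have hmemF : ∀ x ∈ W, blkOf D (site x) = y → iterBlockOf t.j
      (chartBond t (fun x => (site x : Fin (d + 1) → ℤ)) dir x₀ x).src ∈ F := fun x hx hxy =>
    Finset.mem_image.mpr ⟨x, Finset.mem_filter.mpr ⟨hx, hxy⟩, rfl⟩
  refine ⟨F, ?_, hmemF⟩
  by_cases hne : (W.filter (fun x => blkOf D (site x) = y)) = ∅
  · rw [hF, hne, Finset.image_empty, Finset.card_empty]
    exact Nat.zero_le _
  obtain ⟨b₀, hb₀⟩ := Finset.nonempty_iff_ne_empty.mpr hne
  obtain ⟨hb₀W, hb₀y⟩ := Finset.mem_filter.mp hb₀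
  set tl := y.1.1 with ht
  have hwin₀ := hW b₀ hb₀W
  have htlev : D.lev (site b₀ : Fin (d + 1) → ℤ) = tl := lev_eq_of_blkOf_eq D hb₀y
  have ht_range : t.j ≤ tl ∧ tl ≤ t.j + 1 := by
    rw [← htlev]
    exact hlev _ (site b₀).2 hwin₀
  have hL1 : 1 ≤ ℓ + 1 := by omega
  have hLpos : (0 : ℤ) < (((ℓ + 1) ^ t.j : ℕ) : ℤ) := by positivity
  have hdvd : ∀ μ, (((ℓ + 1) ^ t.j : ℕ) : ℤ) ∣ (((ℓ + 1) ^ tl : ℕ) : ℤ) * y.1.2 μ - x₀ μ := fun μ =>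
    dvd_sub (dvd_mul_of_dvd_left (by exact_mod_cast pow_dvd_pow (ℓ + 1) ht_range.1) _) (hx₀ μ)
  set a : Fin (d + 1) → ℤ := fun μ => ((((ℓ + 1) ^ tl : ℕ) : ℤ) * y.1.2 μ - x₀ μ) / (((ℓ + 1) ^ t.j : ℕ) : ℤ) with ha
  set B : Finset (Fin (d + 1) → ℤ) := Fintype.piFinset fun μ => Finset.Ico (a μ) (a μ + (ℓ + 1 : ℕ)) with hB
  have hBcard : B.card = (ℓ + 1) ^ (d + 1) := by
    rw [hB, Fintype.card_piFinset]
    simp only [Int.card_Ico, add_sub_cancel_left, Int.toNat_natCast, Finset.prod_const, Finset.card_univ,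
      Fintype.card_fin]
  have hinto : ∀ s ∈ F, rep (Mk t.P t.j) s ∈ B := by
    intro s hs
    obtain ⟨b, hb, rfl⟩ := Finset.mem_image.mp hs
    obtain ⟨hbW, hby⟩ := Finset.mem_filter.mp hb
    have hwin := hW b hbW
    have hz0 : ∀ μ, 0 ≤ (site b : Fin (d + 1) → ℤ) μ - x₀ μ := fun μ => by have := (hwin μ).1; linarith
    have hzN : ∀ μ, (site b : Fin (d + 1) → ℤ) μ - x₀ μ < (t.P.sitesPerDir 0 : ℕ) := fun μ => by
      refine lt_sitesPerDir_of_window t ?_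
      have := (hwin μ).2
      have hc : ((Wd : ℕ) : ℤ) ≤ (((ℓ + 1) ^ (t.m + t.K) : ℕ) : ℤ) := by exact_mod_cast hWd
      linarith
    rw [hB, Fintype.mem_piFinset]
    intro μ
    rw [Finset.mem_Ico, chartBond_src, rep_iterBlockOf_siteOfInt t hz0 hzN μ]
    obtain ⟨hlo, hhi⟩ := coord_bounds D hby μ
    have hlo' : (((ℓ + 1) ^ tl : ℕ) : ℤ) * y.1.2 μ - x₀ μ ≤ (site b : Fin (d + 1) → ℤ) μ - x₀ μ := by
      have : (((ℓ + 1) ^ y.1.1 : ℕ) : ℤ) = (((ℓ + 1) ^ tl : ℕ) : ℤ) := by rw [ht]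
      linarith
    constructor
    · exact Int.ediv_le_ediv hLpos hlo'
    · refine Int.ediv_lt_of_lt_mul hLpos ?_
      have hmul : a μ * (((ℓ + 1) ^ t.j : ℕ) : ℤ) = (((ℓ + 1) ^ tl : ℕ) : ℤ) * y.1.2 μ - x₀ μ :=
        Int.ediv_mul_cancel (hdvd μ)
      have hpow : (((ℓ + 1) ^ tl : ℕ) : ℤ) ≤ ((ℓ + 1 : ℕ) : ℤ) * (((ℓ + 1) ^ t.j : ℕ) : ℤ) := by
        rw [← Nat.cast_mul, ← pow_succ']
        exact_mod_cast Nat.pow_le_pow_right hL1 ht_range.2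
      have hhi' : (site b : Fin (d + 1) → ℤ) μ < (((ℓ + 1) ^ tl : ℕ) : ℤ) * y.1.2 μ + (((ℓ + 1) ^ tl : ℕ) : ℤ) := by
        have : (((ℓ + 1) ^ y.1.1 : ℕ) : ℤ) = (((ℓ + 1) ^ tl : ℕ) : ℤ) := by rw [ht]
        linarith
      nlinarith
  calc F.card ≤ B.card := Finset.card_le_card_of_injOn (rep (Mk t.P t.j)) hinto ((rep_injective t).injOn)
    _ = (ℓ + 1) ^ (d + 1) := hBcard

variable {D}

/-- **`G_□` IN PRINT'S UNITS ON THE CARRIERS OF THE (2.134) FILES**: `(L^jη)² • transplant W (chartBond …) (onFun G_□^ξ)` on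
`XV i = Fin (d+1) × ↥i.XB` (direction, initial point), `η = L^{−k}` of the member `i : KIdx d ℓ` — the operator `G_□` of (2.90) read on
`T_η` as in `G₀ = Σ h_□G_□h_□`, rescaled by (2.94) `G^η_□ = (L^jη)²G^ξ_□`. [cite: Balaban1984PropagatorsII, (2.90)–(2.91), (2.94) p.239] -/
def GlEta (i : KIdx d ℓ) (W : Finset (XV i)) (x₀ : Fin (d + 1) → ℤ) : Module.End ℝ (XV i → ℝ) :=
  ((((ℓ : ℝ) + 1) ^ t.j * (((nK i : ℕ) : ℝ))⁻¹) ^ 2) •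
    transplant W (chartBond t (fun q : XV i => ((q.2 : ↥(i.XB)) : Fin (d + 1) → ℤ)) (fun q => q.1) x₀) (onFun t.D.G)

/-- **`∇_λG_□` IN PRINT'S UNITS** on the same carriers: `(L^jη) • transplant … (onFun (∇^ξ_λ ∘ G_□^ξ))` (`∇^η G^η_□ = (L^jη)·∇^ξG^ξ_□`, (2.94) «and
correspondingly for derivatives of G_□»). [cite: Balaban1984PropagatorsII, (2.94) p.239, (2.133) p.247] -/
def DGlEta (i : KIdx d ℓ) (lam : Fin t.P.d) (W : Finset (XV i)) (x₀ : Fin (d + 1) → ℤ) : Module.End ℝ (XV i → ℝ) :=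
  ((((ℓ : ℝ) + 1) ^ t.j * (((nK i : ℕ) : ℝ))⁻¹)) •
    transplant W (chartBond t (fun q : XV i => ((q.2 : ↥(i.XB)) : Fin (d + 1) → ℤ)) (fun q => q.1) x₀) (onFun (t.Dl lam ∘ₗ t.D.G))

/-- on blocks of level `≥ j`, `(L^jη)^p ≤ len(y)^p`. [cite: Balaban1984PropagatorsII, (2.1) p.224 («L^jη»), dictionary] -/
private theorem scale_pow_le_len_pow (i : KIdx d ℓ) (p : ℕ) {a : ↥(bset i.D)} (ha : t.j ≤ a.1.1) :
    ((((ℓ : ℝ) + 1) ^ t.j * (((nK i : ℕ) : ℝ))⁻¹)) ^ p ≤ (geoB i).len a ^ p := by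
  rw [geoB_len]
  have hL : (1 : ℝ) ≤ (ℓ : ℝ) + 1 := by
    have : (0 : ℝ) ≤ (ℓ : ℝ) := Nat.cast_nonneg _
    linarith
  have hη : (0 : ℝ) ≤ (((nK i : ℕ) : ℝ))⁻¹ := by positivity
  exact pow_le_pow_left₀ (by positivity) (mul_le_mul_of_nonneg_right (pow_le_pow_right₀ hL ha) hη) p

/-- **(2.133) ⟹ THE `hG` OF `B6Ineq2134ThetaKLevel.ineq2134_kOff_kLevel`** (B6-CLOSURE §5 item 6 (c) delivered in the shape item 6 (b) consumes):
ONE `δ_G > 0`, ONE `C_G ≥ 0` (on `d, L, a₀, a₁`) such that for every two-scale member `t` (scales `j, j+1`), every `i : KIdx d ℓ`, every window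
(corner `x₀ ∈ L^jℤ^{d+1}`, side `≤ L^{m+K}` of the member, all box sites of level `j` or `j+1`), every finite set `W ⊂ XV i` of window bonds and
every reach `S` of blocks of level `≥ j`:
`LocalMajorant (g := geoB i) (blkV i) (GlEta t i W x₀) S (fun y″ y′ => C_G * (geoB i).len y″ ^ 2 * e^{−δ_G·d(y″,y′)})` — with
`C_G = L^{d+1}·A·e^{2δ₂}`, `δ_G = δ₂/(d+1)` from p38's `ineq2133_G` (`δ₂`, `A`). [cite: Balaban1984PropagatorsII, (2.133)–(2.134) p.247, (2.94) p.239, Prop. 2.5 p.246] -/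
theorem reach2133_G_geoB (d ℓ : ℕ) (hd : 1 ≤ d + 1) (hL : Odd (ℓ + 1) ∧ 1 < ℓ + 1) {a₀ a₁ : ℝ} (ha₀ : 0 < a₀) (ha₁ : a₀ ≤ a₁) :
    ∃ δG : ℝ, 0 < δG ∧ ∃ CG : ℝ, 0 ≤ CG ∧ ∀ (t : TSIdx d (ℓ + 1) hd hL a₀ a₁) (i : KIdx d ℓ) (x₀ : Fin (d + 1) → ℤ)
      (_ : ∀ μ, (((ℓ + 1) ^ t.j : ℕ) : ℤ) ∣ x₀ μ) (Wd : ℕ) (_ : Wd ≤ (ℓ + 1) ^ (t.m + t.K))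
      (_ : ∀ z ∈ boxDom (N0 ℓ i.Mh i.k i.P), (∀ μ, x₀ μ ≤ z μ ∧ z μ < x₀ μ + Wd) → t.j ≤ i.D.lev z ∧ i.D.lev z ≤ t.j + 1)
      (W : Finset (XV i)) (_ : ∀ q ∈ W, InWindow (fun q : XV i => ((q.2 : ↥(i.XB)) : Fin (d + 1) → ℤ)) x₀ Wd q)
      (S : Set (geoB i).Site) (_ : ∀ a ∈ S, t.j ≤ a.1.1),
      LocalMajorant (g := geoB i) (blkV i) (GlEta t i W x₀) S
        (fun y'' y' => CG * (geoB i).len y'' ^ 2 * Real.exp (-(δG * (geoB i).dist y'' y'))) := by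
  obtain ⟨δ, hδ, A, hA, h⟩ := reach2133_G d (ℓ + 1) hd hL ha₀ ha₁
  refine ⟨δ / (d + 1), by positivity, ((ℓ + 1) ^ (d + 1) : ℕ) * (A * Real.exp (δ * ((d + 1 : ℝ) + (d + 1)) / (d + 1))),
    by positivity, fun t i x₀ hx₀ Wd hWd hlev W hW S hS => ?_⟩
  classical
  have hloc := h t (g := geoB i) (blkV i) S (fun q : XV i => ((q.2 : ↥(i.XB)) : Fin (d + 1) → ℤ)) (fun q => q.1) x₀ hWd W hW
    (fun q _ q' _ hqq => by
      obtain ⟨h2, h1⟩ := Prod.mk.injEq _ _ _ _ ▸ hqq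
      exact Prod.ext h1 (Subtype.ext h2))
    (d + 1) (d + 1) (by positivity)
    (fun q hq q₁ hq₁ hqS hq₁S => by
      rw [geoB_dist]
      exact hglob_sites t i.D i.hMh i.hP (fun q : XV i => q.2) x₀ Wd (fun z hz hw => (hlev z hz hw).1) W hW S q hq q₁ hq₁ hqS hq₁S)
    ((ℓ + 1) ^ (d + 1)) (fun y _ => hfib_sites t i.D (fun q : XV i => q.2) (fun q => q.1) x₀ hx₀ Wd hWd hlev W hW y)
  refine localMajorant_smul_of_le (g := geoB i) (blkV i) hloc (sq_nonneg _) fun a ha b _ => ?_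
  have hsc := scale_pow_le_len_pow t i 2 (hS a ha)
  have hpos : 0 ≤ (((ℓ + 1) ^ (d + 1) : ℕ) : ℝ) * (A * Real.exp (δ * ((d + 1 : ℝ) + (d + 1)) / (d + 1))) *
      Real.exp (-(δ / (d + 1) * (geoB i).dist a b)) := by positivity
  calc ((((ℓ : ℝ) + 1) ^ t.j * (((nK i : ℕ) : ℝ))⁻¹) ^ 2) *
        ((((ℓ + 1) ^ (d + 1) : ℕ) : ℝ) * ((A * Real.exp (δ * ((d + 1 : ℝ) + (d + 1)) / (d + 1))) *
          Real.exp (-(δ / (d + 1) * (geoB i).dist a b))))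
      = ((((ℓ + 1) ^ (d + 1) : ℕ) : ℝ) * (A * Real.exp (δ * ((d + 1 : ℝ) + (d + 1)) / (d + 1))) *
          Real.exp (-(δ / (d + 1) * (geoB i).dist a b))) * ((((ℓ : ℝ) + 1) ^ t.j * (((nK i : ℕ) : ℝ))⁻¹) ^ 2) := by ring
    _ ≤ ((((ℓ + 1) ^ (d + 1) : ℕ) : ℝ) * (A * Real.exp (δ * ((d + 1 : ℝ) + (d + 1)) / (d + 1))) *
          Real.exp (-(δ / (d + 1) * (geoB i).dist a b))) * (geoB i).len a ^ 2 := mul_le_mul_of_nonneg_left hsc hpos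
    _ = (((ℓ + 1) ^ (d + 1) : ℕ) : ℝ) * (A * Real.exp (δ * ((d + 1 : ℝ) + (d + 1)) / (d + 1))) * (geoB i).len a ^ 2 *
          Real.exp (-(δ / (d + 1) * (geoB i).dist a b)) := by ring

/-- the `∇_λG_□` twin: the `hEG`-type input (weight `len(y″)`, every direction `λ`). [cite: Balaban1984PropagatorsII, (2.133)–(2.134) p.247, (2.94) p.239] -/
theorem reach2133_DG_geoB (d ℓ : ℕ) (hd : 1 ≤ d + 1) (hL : Odd (ℓ + 1) ∧ 1 < ℓ + 1) {a₀ a₁ : ℝ} (ha₀ : 0 < a₀) (ha₁ : a₀ ≤ a₁) :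
    ∃ δG : ℝ, 0 < δG ∧ ∃ CG : ℝ, 0 ≤ CG ∧ ∀ (t : TSIdx d (ℓ + 1) hd hL a₀ a₁) (lam : Fin t.P.d) (i : KIdx d ℓ) (x₀ : Fin (d + 1) → ℤ)
      (_ : ∀ μ, (((ℓ + 1) ^ t.j : ℕ) : ℤ) ∣ x₀ μ) (Wd : ℕ) (_ : Wd ≤ (ℓ + 1) ^ (t.m + t.K))
      (_ : ∀ z ∈ boxDom (N0 ℓ i.Mh i.k i.P), (∀ μ, x₀ μ ≤ z μ ∧ z μ < x₀ μ + Wd) → t.j ≤ i.D.lev z ∧ i.D.lev z ≤ t.j + 1)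
      (W : Finset (XV i)) (_ : ∀ q ∈ W, InWindow (fun q : XV i => ((q.2 : ↥(i.XB)) : Fin (d + 1) → ℤ)) x₀ Wd q)
      (S : Set (geoB i).Site) (_ : ∀ a ∈ S, t.j ≤ a.1.1),
      LocalMajorant (g := geoB i) (blkV i) (DGlEta t i lam W x₀) S
        (fun y'' y' => CG * (geoB i).len y'' * Real.exp (-(δG * (geoB i).dist y'' y'))) := by
  obtain ⟨δ, hδ, A, hA, h⟩ := reach2133_DG d (ℓ + 1) hd hL ha₀ ha₁
  refine ⟨δ / (d + 1), by positivity, ((ℓ + 1) ^ (d + 1) : ℕ) * (A * Real.exp (δ * ((d + 1 : ℝ) + (d + 1)) / (d + 1))),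
    by positivity, fun t lam i x₀ hx₀ Wd hWd hlev W hW S hS => ?_⟩
  classical
  have hloc := h t lam (g := geoB i) (blkV i) S (fun q : XV i => ((q.2 : ↥(i.XB)) : Fin (d + 1) → ℤ)) (fun q => q.1) x₀ hWd W hW
    (fun q _ q' _ hqq => by
      obtain ⟨h2, h1⟩ := Prod.mk.injEq _ _ _ _ ▸ hqq
      exact Prod.ext h1 (Subtype.ext h2))
    (d + 1) (d + 1) (by positivity)
    (fun q hq q₁ hq₁ hqS hq₁S => by
      rw [geoB_dist]
      exact hglob_sites t i.D i.hMh i.hP (fun q : XV i => q.2) x₀ Wd (fun z hz hw => (hlev z hz hw).1) W hW S q hq q₁ hq₁ hqS hq₁S)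
    ((ℓ + 1) ^ (d + 1)) (fun y _ => hfib_sites t i.D (fun q : XV i => q.2) (fun q => q.1) x₀ hx₀ Wd hWd hlev W hW y)
  refine localMajorant_smul_of_le (g := geoB i) (blkV i) hloc (by positivity) fun a ha b _ => ?_
  have hsc := scale_pow_le_len_pow t i 1 (hS a ha)
  rw [pow_one, pow_one] at hsc
  have hpos : 0 ≤ (((ℓ + 1) ^ (d + 1) : ℕ) : ℝ) * (A * Real.exp (δ * ((d + 1 : ℝ) + (d + 1)) / (d + 1))) *
      Real.exp (-(δ / (d + 1) * (geoB i).dist a b)) := by positivity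
  calc ((((ℓ : ℝ) + 1) ^ t.j * (((nK i : ℕ) : ℝ))⁻¹)) *
        ((((ℓ + 1) ^ (d + 1) : ℕ) : ℝ) * ((A * Real.exp (δ * ((d + 1 : ℝ) + (d + 1)) / (d + 1))) *
          Real.exp (-(δ / (d + 1) * (geoB i).dist a b))))
      = ((((ℓ + 1) ^ (d + 1) : ℕ) : ℝ) * (A * Real.exp (δ * ((d + 1 : ℝ) + (d + 1)) / (d + 1))) *
          Real.exp (-(δ / (d + 1) * (geoB i).dist a b))) * ((((ℓ : ℝ) + 1) ^ t.j * (((nK i : ℕ) : ℝ))⁻¹)) := by ring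
    _ ≤ ((((ℓ + 1) ^ (d + 1) : ℕ) : ℝ) * (A * Real.exp (δ * ((d + 1 : ℝ) + (d + 1)) / (d + 1))) *
          Real.exp (-(δ / (d + 1) * (geoB i).dist a b))) * (geoB i).len a := mul_le_mul_of_nonneg_left hsc hpos
    _ = (((ℓ + 1) ^ (d + 1) : ℕ) : ℝ) * (A * Real.exp (δ * ((d + 1 : ℝ) + (d + 1)) / (d + 1))) * (geoB i).len a *
          Real.exp (-(δ / (d + 1) * (geoB i).dist a b)) := by ring

end GeoB

/-! ## §8  (v1.2) Localisation of the transplanted operators: `OutLoc` / `InLoc` off the blocks met by the window (the hypotheses `hGout` of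
`B6Ineq2134Diag.diag_hasMajorant` / `hKout` of the gluing, asked by p38 gen 25 for (b′)) -/

section Loc

open B6Prop26Gluing (OutLoc InLoc)
open B6Prop25TwoScaleCensus (TSIdx)
open B6Prop22KLevelCensus (KIdx)
open B6Ineq288MultiLevelBox (geoB)
open B6Ineq2134ThetaKLevel (XV blkV)

variable {X X' : Type} [DecidableEq X'] [DecidableEq X] {W : Finset X} {e : X → X'}

/-- **OUTPUT LOCALISATION OF THE TRANSPLANT**: `(ε T′ ρ f)(x) = 0` off the window, hence off any set of blocks `T ⊇ blk(W)` — the extension by zero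
(the hypothesis `hGout`/`hKout` shape of `B6Ineq2134Diag.diag_hasMajorant` / `B6Prop26Gluing.prop26_2136_of_2133_2134`). [cite: Balaban1984PropagatorsII, (2.91)–(2.93) p.239 (supports of h_□, ζ_□), p.238 (T_□); derivation ours] -/
theorem outLoc_transplant {g : B6.Geometry} (blk : X → g.Site) {T : Set g.Site} (hWT : ∀ x ∈ W, blk x ∈ T)
    (T' : Module.End ℝ (X' → ℝ)) : OutLoc blk (transplant W e T') T := by
  intro v x hx
  rw [transplant_apply]
  split_ifs with hxW
  · exact absurd (hWT x hxW) hx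
  · rfl

/-- **INPUT LOCALISATION OF THE TRANSPLANT**: a source supported in a block not met by the window is killed (`ρμ = 0` on `e(W)`).
[cite: Balaban1984PropagatorsII, (2.91) p.239, p.238 (T_□); derivation ours] -/
theorem inLoc_transplant {g : B6.Geometry} (blk : X → g.Site) {T : Set g.Site} (hWT : ∀ x ∈ W, blk x ∈ T) (hinj : Set.InjOn e ↑W)
    (T' : Module.End ℝ (X' → ℝ)) : InLoc blk (transplant W e T') T := by
  intro y' μ B hμ hy'
  have hρ : restrictOp W e μ = 0 := by
    funext x'
    rw [Pi.zero_apply]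
    by_cases h : ∃ x ∈ W, e x = x'
    · obtain ⟨x, hx, rfl⟩ := h
      rw [restrictOp_apply_of_injOn hinj μ hx]
      exact hμ.off x fun hb => hy' (hb ▸ hWT x hx)
    · exact restrictOp_apply_of_not_mem μ fun x hx hex => h ⟨x, hx, hex⟩
  funext v
  rw [transplant_apply, hρ, map_zero]
  simp

omit [DecidableEq X'] [DecidableEq X] in
/-- localisation survives scaling. [folklore] -/
private theorem outLoc_smul {g : B6.Geometry} {blk : X → g.Site} {T : Module.End ℝ (X → ℝ)} {S : Set g.Site} (h : OutLoc blk T S) (c : ℝ) :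
    OutLoc blk (c • T) S := fun v x hx => by
  rw [LinearMap.smul_apply, Pi.smul_apply, h v x hx, smul_zero]

omit [DecidableEq X'] [DecidableEq X] in
/-- localisation survives scaling (input side). [folklore] -/
private theorem inLoc_smul {g : B6.Geometry} {blk : X → g.Site} {T : Module.End ℝ (X → ℝ)} {S : Set g.Site} (h : InLoc blk T S) (c : ℝ) :
    InLoc blk (c • T) S := fun y' μ B hμ hy' => by
  rw [LinearMap.smul_apply, h y' μ B hμ hy', smul_zero]

variable {d ℓ : ℕ} {hd : 1 ≤ d + 1} {hL : Odd (ℓ + 1) ∧ 1 < ℓ + 1} {a₀ a₁ : ℝ} (t : TSIdx d (ℓ + 1) hd hL a₀ a₁)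

/-- `hGout` for `GlEta`: the transplanted `G_□` (η-units) writes only on the blocks met by the window. [cite: Balaban1984PropagatorsII, (2.91)–(2.92) p.239; derivation ours] -/
theorem outLoc_GlEta (i : KIdx d ℓ) (W : Finset (XV i)) (x₀ : Fin (d + 1) → ℤ) {T : Set (geoB i).Site} (hWT : ∀ q ∈ W, blkV i q ∈ T) :
    OutLoc (blkV i) (GlEta t i W x₀) T :=
  outLoc_smul (outLoc_transplant (g := geoB i) (blkV i) hWT _) _

/-- `hGout` for `DGlEta`. [cite: Balaban1984PropagatorsII, (2.91)–(2.92) p.239; derivation ours] -/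
theorem outLoc_DGlEta (i : KIdx d ℓ) (lam : Fin t.P.d) (W : Finset (XV i)) (x₀ : Fin (d + 1) → ℤ) {T : Set (geoB i).Site}
    (hWT : ∀ q ∈ W, blkV i q ∈ T) : OutLoc (blkV i) (DGlEta t i lam W x₀) T :=
  outLoc_smul (outLoc_transplant (g := geoB i) (blkV i) hWT _) _

/-- input localisation for `GlEta` (the window of side `≤ L^{m+K}` makes the chart injective, `injOn_chartBond`). [cite: Balaban1984PropagatorsII, (2.91) p.239; derivation ours] -/
theorem inLoc_GlEta (i : KIdx d ℓ) (W : Finset (XV i)) (x₀ : Fin (d + 1) → ℤ) {Wd : ℕ} (hWd : Wd ≤ (ℓ + 1) ^ (t.m + t.K))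
    (hW : ∀ q ∈ W, InWindow (fun q : XV i => ((q.2 : ↥(i.XB)) : Fin (d + 1) → ℤ)) x₀ Wd q) {T : Set (geoB i).Site}
    (hWT : ∀ q ∈ W, blkV i q ∈ T) : InLoc (blkV i) (GlEta t i W x₀) T := by
  classical
  refine inLoc_smul (inLoc_transplant (g := geoB i) (blkV i) hWT ?_ _) _
  refine injOn_chartBond t _ _ x₀ hWd W hW ?_
  intro q _ q' _ hqq
  simp only [Prod.mk.injEq] at hqq
  exact Prod.ext hqq.2 (Subtype.ext hqq.1)

end Loc

/-! ## §9 (v1.3)  THE BIJECTIVE WINDOW `□̃³ = T_□` (p. 238: *"We take the cube □̃³ and identify it with a torus, denoted by T_□, imposing periodicity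
conditions"*): when the chart is a BIJECTION of the window onto the local lattice, `ρ ∘ ε = 1`, the transplant is MULTIPLICATIVE, and the local
inversion `Δ_□G_□ = 1` on `T_□` transplants to the INVERSION HYPOTHESIS `(M_□ − P_□)·G_□·h_□ = h_□` of (2.91) (`B6Eq291Generator.eq291`'s `hinv`)
for every `h_□` supported in the window -/

section Bijective

open B6Prop26Gluing (mulOp mulOp_apply)

variable {X X' : Type} [DecidableEq X'] [DecidableEq X] {W : Finset X} {e : X → X'}

/-- for a bijective chart the round trip `T_□ → T_η → T_□` is the identity: `ρ(εg) = g`. [cite: Balaban1984PropagatorsII, p.238 (T_□ = □̃³ with periodicity), dictionary] -/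
theorem restrictOp_extendOp_of_bij (hinj : Set.InjOn e ↑W) (hsurj : ∀ x', ∃ x ∈ W, e x = x') (g : X' → ℝ) :
    restrictOp W e (extendOp W e g) = g := by
  funext x'
  obtain ⟨x, hx, rfl⟩ := hsurj x'
  exact restrictOp_extendOp_apply hinj g hx

/-- **THE TRANSPLANT THROUGH A BIJECTIVE WINDOW IS MULTIPLICATIVE**: `ε(T′₁T′₂)ρ = (εT′₁ρ)(εT′₂ρ)` — operator identities on `T_□` (such as
`Δ_□G_□ = 1`) survive the identification `T_□ = □̃³ ⊂ T_η`. [cite: Balaban1984PropagatorsII, p.238 (T_□), (2.90)–(2.91) p.239, dictionary] -/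
theorem transplant_mul_of_bij (hinj : Set.InjOn e ↑W) (hsurj : ∀ x', ∃ x ∈ W, e x = x') (T₁ T₂ : Module.End ℝ (X' → ℝ)) :
    transplant W e (T₁ * T₂) = transplant W e T₁ * transplant W e T₂ := by
  apply LinearMap.ext
  intro f
  simp only [transplant, Module.End.mul_eq_comp, LinearMap.comp_apply, restrictOp_extendOp_of_bij hinj hsurj]

/-- the transplant is linear in the local operator: differences. [cite: Balaban1984PropagatorsII, (2.90) p.239 («Δ − ∂P_□∂* + Q*aQ»), dictionary] -/
theorem transplant_sub (T₁ T₂ : Module.End ℝ (X' → ℝ)) : transplant W e (T₁ - T₂) = transplant W e T₁ - transplant W e T₂ := by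
  simp only [transplant, LinearMap.sub_comp, LinearMap.comp_sub]

/-- the transplant is linear in the local operator: sums. [cite: Balaban1984PropagatorsII, (2.90) p.239, dictionary] -/
theorem transplant_add (T₁ T₂ : Module.End ℝ (X' → ℝ)) : transplant W e (T₁ + T₂) = transplant W e T₁ + transplant W e T₂ := by
  simp only [transplant, LinearMap.add_comp, LinearMap.comp_add]

/-- the transplant is linear in the local operator: scalars (the unit factors of (2.94)). [cite: Balaban1984PropagatorsII, (2.94) p.239, dictionary] -/
theorem transplant_smul (c : ℝ) (T₁ : Module.End ℝ (X' → ℝ)) : transplant W e (c • T₁) = c • transplant W e T₁ := by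
  simp only [transplant, LinearMap.smul_comp, LinearMap.comp_smul]

/-- the transplant of the identity is the cut-off to the window: `(ε1ρ)·h = h·` for `h` supported in the window.
[cite: Balaban1984PropagatorsII, p.238 (T_□), (2.91) p.239 (supp h_□ ⊂ □̃), dictionary] -/
theorem transplant_one_mul_mulOp (hinj : Set.InjOn e ↑W) (h : X → ℝ) (hh : ∀ x, h x ≠ 0 → x ∈ W) :
    transplant W e 1 * mulOp h = mulOp h := by
  apply LinearMap.ext
  intro f
  funext x
  rw [Module.End.mul_apply, transplant_apply, Module.End.one_apply, mulOp_apply]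
  by_cases hx : x ∈ W
  · rw [if_pos hx, restrictOp_apply_of_injOn hinj _ hx, mulOp_apply]
  · rw [if_neg hx]
    have h0 : h x = 0 := by
      by_contra hne
      exact hx (hh x hne)
    rw [h0, zero_mul]

/-- **THE INVERSION HYPOTHESIS OF (2.91) FROM `Δ_□G_□ = 1` ON `T_□`** (bijective window): if `D_□·G_□ = 1` on the local torus, then for the
transplanted operators `(εD_□ρ)·(εG_□ρ)·h_□ = h_□` for every `h_□` supported in the window — `eq291`'s `hinv` with `M_□ − P_□ := εD_□ρ`.
[cite: Balaban1984PropagatorsII, (2.90)–(2.91) p.239, p.238 (T_□)] -/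
theorem transplant_inv_mul_mulOp (hinj : Set.InjOn e ↑W) (hsurj : ∀ x', ∃ x ∈ W, e x = x') {Dl Gl : Module.End ℝ (X' → ℝ)}
    (hDG : Dl * Gl = 1) (h : X → ℝ) (hh : ∀ x, h x ≠ 0 → x ∈ W) :
    transplant W e Dl * transplant W e Gl * mulOp h = mulOp h := by
  rw [← transplant_mul_of_bij hinj hsurj, hDG, transplant_one_mul_mulOp hinj h hh]

/-- the same with the unit factors of (2.94): `(c•εD_□ρ)·(c⁻¹•εG_□ρ)·h_□ = h_□` (`c ≠ 0`; e.g. `c = (L^jη)^{−2}`).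
[cite: Balaban1984PropagatorsII, (2.94) p.239, (2.91) p.239] -/
theorem transplant_inv_mul_mulOp_smul (hinj : Set.InjOn e ↑W) (hsurj : ∀ x', ∃ x ∈ W, e x = x') {Dl Gl : Module.End ℝ (X' → ℝ)}
    (hDG : Dl * Gl = 1) {c : ℝ} (hc : c ≠ 0) (h : X → ℝ) (hh : ∀ x, h x ≠ 0 → x ∈ W) :
    (c • transplant W e Dl) * (c⁻¹ • transplant W e Gl) * mulOp h = mulOp h := by
  rw [smul_mul_smul_comm, mul_inv_cancel₀ hc, one_smul, transplant_inv_mul_mulOp hinj hsurj hDG h hh]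

/-- with the local operator split as `D_□ = M_□ − P_□` (local part minus projection part, (2.90)) the transplanted split inverts:
`(c•εM_□ρ − c•εP_□ρ)·(c⁻¹•εG_□ρ)·h_□ = h_□` — LITERALLY the `hinvl` hypothesis of `B6GlobalChartV1.prop26_2136_V1_of_2134_eq291` /
`hinv` of `B6Eq291Generator.eq291`. [cite: Balaban1984PropagatorsII, (2.90)–(2.91) p.239] -/
theorem hinv_of_bij (hinj : Set.InjOn e ↑W) (hsurj : ∀ x', ∃ x ∈ W, e x = x') {Ml Pl Gl : Module.End ℝ (X' → ℝ)}
    (hDG : (Ml - Pl) * Gl = 1) {c : ℝ} (hc : c ≠ 0) (h : X → ℝ) (hh : ∀ x, h x ≠ 0 → x ∈ W) :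
    (c • transplant W e Ml - c • transplant W e Pl) * (c⁻¹ • transplant W e Gl) * mulOp h = mulOp h := by
  have hsplit : c • transplant W e Ml - c • transplant W e Pl = c • transplant W e (Ml - Pl) := by
    rw [transplant_sub, smul_sub]
  rw [hsplit]
  exact transplant_inv_mul_mulOp_smul hinj hsurj hDG hc h hh

end Bijective

/-! ### §9b  The full window of `T_□` is a bijective chart -/

section FullWindow

open B6Prop25TwoScaleCensus (TSIdx)

variable {d L : ℕ} {hd : 1 ≤ d + 1} {hL : Odd L ∧ 1 < L} {a₀ a₁ : ℝ} (i : TSIdx d L hd hL a₀ a₁)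

/-- the chart inverts the label map on the fundamental domain: `siteOfInt (val s) = s`. [cite: Balaban1984PropagatorsI, (1.6) p.18, dictionary] -/
theorem siteOfInt_val (s : Site i.P 0) : siteOfInt i (fun μ => (((s μ).val : ℕ) : ℤ)) = s := by
  funext μ
  simp only [siteOfInt, Int.toNat_natCast, ZMod.natCast_zmod_val]

/-- injectivity of the bond chart on ANY window of side at most the fine period `2L^{m+K}` of `T_□` (the full fundamental domain included).
[cite: Balaban1984PropagatorsII, p.238 (T_□ = □̃³), dictionary] -/
theorem injOn_chartBond_full {X : Type} (pos : X → Fin (d + 1) → ℤ) (dir : X → Fin (d + 1)) (x₀ : Fin (d + 1) → ℤ) {Wd : ℕ}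
    (hWd : Wd ≤ i.P.sitesPerDir 0) (W : Finset X) (hW : ∀ x ∈ W, InWindow pos x₀ Wd x)
    (hinj : Set.InjOn (fun x => (pos x, dir x)) ↑W) : Set.InjOn (chartBond i pos dir x₀) ↑W := by
  intro x hx x₁ hx₁ h
  have hwin : ∀ {x}, x ∈ W → (∀ μ, 0 ≤ pos x μ - x₀ μ) ∧ ∀ μ, pos x μ - x₀ μ < (i.P.sitesPerDir 0 : ℕ) := by
    intro x hx
    refine ⟨fun μ => by have := (hW x hx μ).1; linarith, fun μ => ?_⟩
    have := (hW x hx μ).2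
    have hc : ((Wd : ℕ) : ℤ) ≤ ((i.P.sitesPerDir 0 : ℕ) : ℤ) := by exact_mod_cast hWd
    linarith
  have hsrc := congrArg PBond.src h
  have hdir : dir x = dir x₁ := congrArg PBond.dir h
  simp only [chartBond_src] at hsrc
  have hpos : pos x = pos x₁ := by
    funext μ
    have h1 := val_siteOfInt i (hwin hx).1 (hwin hx).2 μ
    have h2 := val_siteOfInt i (hwin hx₁).1 (hwin hx₁).2 μ
    rw [hsrc] at h1
    have : pos x μ - x₀ μ = pos x₁ μ - x₀ μ := by rw [← h1, ← h2]
    linarith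
  exact hinj hx hx₁ (Prod.ext hpos hdir)

/-- **THE FULL WINDOW IS ONTO `T_□`**: if the window has the full side `2L^{m+K}` and contains a point with every position/direction in it,
every bond of `T_□` is charted (with `injOn_chartBond_full`: the identification `□̃³ = T_□` is a bijection).
[cite: Balaban1984PropagatorsII, p.238 (T_□ = □̃³ with periodicity conditions), dictionary] -/
theorem surj_chartBond_full {X : Type} (pos : X → Fin (d + 1) → ℤ) (dir : X → Fin (d + 1)) (x₀ : Fin (d + 1) → ℤ) (W : Finset X)
    (hfull : ∀ z : Fin (d + 1) → ℤ, (∀ μ, x₀ μ ≤ z μ ∧ z μ < x₀ μ + (i.P.sitesPerDir 0 : ℕ)) →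
      ∀ ν : Fin (d + 1), ∃ x ∈ W, pos x = z ∧ dir x = ν) :
    ∀ b' : PBond i.P 0, ∃ x ∈ W, chartBond i pos dir x₀ x = b' := by
  intro b'
  obtain ⟨x, hx, hpos, hdir⟩ := hfull (fun μ => x₀ μ + (((b'.src μ).val : ℕ) : ℤ)) (fun μ => ⟨le_add_of_nonneg_right (Int.natCast_nonneg _), by
      have := ZMod.val_lt (b'.src μ)
      linarith [show (((b'.src μ).val : ℕ) : ℤ) < ((i.P.sitesPerDir 0 : ℕ) : ℤ) by exact_mod_cast this]⟩) b'.dir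
  refine ⟨x, hx, ?_⟩
  have hsrc : (chartBond i pos dir x₀ x).src = b'.src := by
    rw [chartBond_src]
    have : (fun μ => pos x μ - x₀ μ) = fun μ => (((b'.src μ).val : ℕ) : ℤ) := by
      funext μ
      rw [hpos]
      ring
    rw [this, siteOfInt_val]
  cases b'
  simp only [chartBond] at hsrc ⊢
  simp only at hdir
  rw [hdir]
  congr 1

end FullWindow

/-! ### §9c  (2.133) through a LARGE window with the reach in a HALF-PERIOD sub-window (the transplant may use the full fundamental domain
`□̃³ = T_□`, side `2L^{m+K}`; the kernel comparison torus distance = flat distance is needed only for pairs over the reach `S ⊂ □̃`, which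
sits in a sub-window of side `≤ L^{m+K}` with corner in `x₀ + L^jℤ^{d+1}`) -/

section ShiftedWindow

open B6RandomWalk (HasMajorant)
open B6Prop26Gluing (LocalMajorant)
open B5Eq118OneStroke (iterBlockOf)
open B6LowerBound2153Torus (rep)
open B5Eq117TorusCarriers (Mk)
open B4ContourShift (supNorm abs_le_supNorm supNorm_nonneg)
open B4TorusKernel.MultiPeriod (torusSupNorm torusSupNorm_of_centred)
open B6Prop25TwoScaleCensus (TSIdx)
open B6Ineq2133TwoScaleV1 (tsGeo onFun ineq2133_G ineq2133_DG)

variable {d L : ℕ} {hd : 1 ≤ d + 1} {hL : Odd L ∧ 1 < L} {a₀ a₁ : ℝ} (i : TSIdx d L hd hL a₀ a₁)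

/-- labels of a shifted sub-window: `a ≤ z < a + L^{m+K}`, `L^j ∣ a` ⟹ `a/L^j ≤ ⌊z/L^j⌋ < a/L^j + L^{m+K−j}`. [folklore] -/
private theorem ediv_window_shift {a z : ℤ} (ha : ((L ^ i.j : ℕ) : ℤ) ∣ a) (haz : a ≤ z) (hza : z < a + ((L ^ (i.m + i.K) : ℕ) : ℤ)) :
    a / ((L ^ i.j : ℕ) : ℤ) ≤ z / ((L ^ i.j : ℕ) : ℤ) ∧
      z / ((L ^ i.j : ℕ) : ℤ) < a / ((L ^ i.j : ℕ) : ℤ) + ((L ^ (i.m + i.K - i.j) : ℕ) : ℤ) := by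
  have hL0 : 0 < L := by have := hL.2; omega
  have hn : (0 : ℤ) < ((L ^ i.j : ℕ) : ℤ) := by positivity
  refine ⟨Int.ediv_le_ediv hn haz, Int.ediv_lt_of_lt_mul hn ?_⟩
  have hpow : ((L ^ (i.m + i.K) : ℕ) : ℤ) = ((L ^ (i.m + i.K - i.j) : ℕ) : ℤ) * ((L ^ i.j : ℕ) : ℤ) := by
    rw [← Nat.cast_mul, ← pow_add, Nat.sub_add_cancel (Nat.le_of_succ_le i.hjP)]
  obtain ⟨q, hq⟩ := ha
  have haq : a / ((L ^ i.j : ℕ) : ℤ) = q := by rw [hq, Int.mul_ediv_cancel_left _ hn.ne']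
  rw [haq, add_mul, hpow.symm]
  calc z < a + ((L ^ (i.m + i.K) : ℕ) : ℤ) := hza
    _ = q * ((L ^ i.j : ℕ) : ℤ) + ((L ^ (i.m + i.K) : ℕ) : ℤ) := by rw [hq, mul_comm]

/-- **TORUS DISTANCE = FLAT DISTANCE ON A HALF-PERIOD SUB-WINDOW, ANYWHERE IN THE FUNDAMENTAL DOMAIN**: for `z, z₁` with `a ≤ z, z₁ < a + L^{m+K}`
coordinatewise (`a ∈ L^jℤ^{d+1}`, `0 ≤ a`, and `z, z₁` inside the fine period `2L^{m+K}`), `|z − z₁|_∞ ≤ L^j·|y − y₁|_T + (L^j − 1)` for the `j`-blocks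
`y, y₁` of the charted points (v1's `supNorm_sub_le_tdist` is the case `a = 0`). [cite: Balaban1984PropagatorsI, (1.18) p.20, (1.29) p.23 (the torus `T′`; the block distance on it is the tree's dictionary), dictionary] -/
theorem supNorm_sub_le_tdist_shift {a z z₁ : Fin (d + 1) → ℤ} (ha : ∀ μ, ((L ^ i.j : ℕ) : ℤ) ∣ a μ) (ha0 : ∀ μ, 0 ≤ a μ)
    (haz : ∀ μ, a μ ≤ z μ) (haz₁ : ∀ μ, a μ ≤ z₁ μ)
    (hza : ∀ μ, z μ < a μ + ((L ^ (i.m + i.K) : ℕ) : ℤ)) (hz₁a : ∀ μ, z₁ μ < a μ + ((L ^ (i.m + i.K) : ℕ) : ℤ))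
    (hzN : ∀ μ, z μ < (i.P.sitesPerDir 0 : ℕ)) (hz₁N : ∀ μ, z₁ μ < (i.P.sitesPerDir 0 : ℕ)) :
    supNorm (z - z₁) ≤ ((L ^ i.j : ℕ) : ℝ) * i.tdist (iterBlockOf i.j (siteOfInt i z)) (iterBlockOf i.j (siteOfInt i z₁)) +
      (((L ^ i.j : ℕ) : ℝ) - 1) := by
  have hL0 : 0 < L := by have := hL.2; omega
  have hn : (0 : ℤ) < ((L ^ i.j : ℕ) : ℤ) := by positivity
  have hz0 : ∀ μ, 0 ≤ z μ := fun μ => (ha0 μ).trans (haz μ)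
  have hz₁0 : ∀ μ, 0 ≤ z₁ μ := fun μ => (ha0 μ).trans (haz₁ μ)
  set q : Fin (d + 1) → ℤ := rep (Mk i.P i.j) (iterBlockOf i.j (siteOfInt i z)) with hqdef
  set q₁ : Fin (d + 1) → ℤ := rep (Mk i.P i.j) (iterBlockOf i.j (siteOfInt i z₁)) with hq₁def
  have hq : ∀ μ, q μ = z μ / ((L ^ i.j : ℕ) : ℤ) := fun μ => rep_iterBlockOf_siteOfInt i hz0 hzN μ
  have hq₁ : ∀ μ, q₁ μ = z₁ μ / ((L ^ i.j : ℕ) : ℤ) := fun μ => rep_iterBlockOf_siteOfInt i hz₁0 hz₁N μ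
  -- the label difference is centred, so the torus distance of the labels is their sup-distance
  have hcen : ∀ μ, 2 * |(q - q₁) μ| ≤ (Mk i.P i.j μ : ℤ) := by
    intro μ
    have hM : (Mk i.P i.j μ : ℤ) = 2 * ((L ^ (i.m + i.K - i.j) : ℕ) : ℤ) := by
      show ((i.P.sitesPerDir i.j : ℕ) : ℤ) = _
      rw [sitesPerDir_j]
      push_cast
      ring
    rw [hM, Pi.sub_apply, hq μ, hq₁ μ]
    obtain ⟨hlo, hhi⟩ := ediv_window_shift i (ha μ) (haz μ) (hza μ)
    obtain ⟨hlo₁, hhi₁⟩ := ediv_window_shift i (ha μ) (haz₁ μ) (hz₁a μ)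
    have habs : |z μ / ((L ^ i.j : ℕ) : ℤ) - z₁ μ / ((L ^ i.j : ℕ) : ℤ)| ≤ ((L ^ (i.m + i.K - i.j) : ℕ) : ℤ) := by
      rw [abs_le]
      constructor <;> linarith
    linarith
  have htd : i.tdist (iterBlockOf i.j (siteOfInt i z)) (iterBlockOf i.j (siteOfInt i z₁)) = supNorm (q - q₁) := by
    show torusSupNorm (Mk i.P i.j) (q - q₁) = supNorm (q - q₁)
    exact torusSupNorm_of_centred (fun μ => NeZero.one_le) hcen
  rw [htd]
  have hnR : (0 : ℝ) ≤ ((L ^ i.j : ℕ) : ℝ) := by positivity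
  unfold supNorm
  refine Finset.sup'_le _ _ fun μ _ => ?_
  have hμ : ((|(q - q₁) μ| : ℤ) : ℝ) ≤ Finset.univ.sup' Finset.univ_nonempty (fun ν => ((|(q - q₁) ν| : ℤ) : ℝ)) :=
    abs_le_supNorm (q - q₁) μ
  have hint : |(z - z₁) μ| ≤ ((L ^ i.j : ℕ) : ℤ) * |(q - q₁) μ| + (((L ^ i.j : ℕ) : ℤ) - 1) := by
    rw [Pi.sub_apply, Pi.sub_apply, hq μ, hq₁ μ]
    exact abs_sub_le_mul_abs_ediv_sub _ hn _ _
  have hcast : ((|(z - z₁) μ| : ℤ) : ℝ) ≤ ((L ^ i.j : ℕ) : ℝ) * ((|(q - q₁) μ| : ℤ) : ℝ) + (((L ^ i.j : ℕ) : ℝ) - 1) := by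
    have := (Int.cast_le (R := ℝ)).mpr hint
    push_cast at this ⊢
    exact this
  nlinarith [mul_le_mul_of_nonneg_left hμ hnR]

/-- **THE BRIDGE THROUGH A LARGE WINDOW** (v1's `localMajorant_transplant_of_window` with the window enlarged up to the full period
`2L^{m+K}` of `T_□` — so that the chart may be the BIJECTION `□̃³ = T_□` — and the reach `S` confined to a half-period sub-window with corner
`x₁ ∈ x₀ + L^jℤ^{d+1}`): same conclusion `LocalMajorant blk (ε G_□ ρ) S (n·A·e^{δ(κ+c)/κ}·e^{−(δ/κ)d})`.
[cite: Balaban1984PropagatorsII, (2.133) p.247, p.238 (T_□ = □̃³), (2.90)–(2.91) p.239] -/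
theorem localMajorant_transplant_of_window₂ (R M : ℝ) {X : Type} [DecidableEq X] {g : B6.Geometry}
    (blk : X → g.Site) (S : Set g.Site) (pos : X → Fin (d + 1) → ℤ) (dir : X → Fin (d + 1)) (x₀ : Fin (d + 1) → ℤ)
    {Wd : ℕ} (hWd : Wd ≤ i.P.sitesPerDir 0) (W : Finset X) (hW : ∀ x ∈ W, InWindow pos x₀ Wd x)
    (hinj : Set.InjOn (fun x => (pos x, dir x)) ↑W)
    (x₁ : Fin (d + 1) → ℤ) (hx₁ : ∀ μ, ((L ^ i.j : ℕ) : ℤ) ∣ x₁ μ - x₀ μ) (hx₀₁ : ∀ μ, x₀ μ ≤ x₁ μ) {Wd₁ : ℕ} (hWd₁ : Wd₁ ≤ L ^ (i.m + i.K))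
    (hS : ∀ x ∈ W, blk x ∈ S → InWindow pos x₁ Wd₁ x)
    {T' : Module.End ℝ (PBond i.P 0 → ℝ)} {A δ : ℝ} (hA : 0 ≤ A) (hδ : 0 ≤ δ)
    (hT' : HasMajorant (g := tsGeo i R M) (fun b : PBond i.P 0 => iterBlockOf i.j b.src) T'
      (fun y y' => A * Real.exp (-(δ * i.tdist y y'))))
    (κ c : ℝ) (hκ : 0 < κ)
    (hglob : ∀ x ∈ W, ∀ x₁ ∈ W, blk x ∈ S → blk x₁ ∈ S →
      g.dist (blk x) (blk x₁) ≤ κ * (supNorm (pos x - pos x₁) / ((L ^ i.j : ℕ) : ℝ)) + c)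
    (n : ℕ) (hfib : ∀ y ∈ S, ∃ T : Finset (Site i.P i.j), T.card ≤ n ∧
      ∀ x ∈ W, blk x = y → iterBlockOf i.j (chartBond i pos dir x₀ x).src ∈ T) :
    LocalMajorant blk (transplant W (chartBond i pos dir x₀) T') S
      (fun a b => n * ((A * Real.exp (δ * (κ + c) / κ)) * Real.exp (-(δ / κ * g.dist a b)))) := by
  classical
  have hL0 : 0 < L := by have := hL.2; omega
  have hnpos : (0 : ℝ) < ((L ^ i.j : ℕ) : ℝ) := by positivity
  refine localMajorant_transplant (g' := tsGeo i R M) blk (fun b : PBond i.P 0 => iterBlockOf i.j b.src) S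
    (injOn_chartBond_full i pos dir x₀ hWd W hW hinj) hT' _ (fun a b => ?_) (fun x hx x' hx' hxS hx'S => ?_) n hfib
  · positivity
  · -- window points are inside the fine period; S-points are inside the shifted half-period sub-window
    have hwin : ∀ {x}, x ∈ W → ∀ μ, pos x μ - x₀ μ < (i.P.sitesPerDir 0 : ℕ) := by
      intro x hx μ
      have := (hW x hx μ).2
      have hc : ((Wd : ℕ) : ℤ) ≤ ((i.P.sitesPerDir 0 : ℕ) : ℤ) := by exact_mod_cast hWd
      linarith
    have hsub₁ : ∀ {x}, x ∈ W → blk x ∈ S →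
        (∀ μ, x₁ μ - x₀ μ ≤ pos x μ - x₀ μ) ∧ ∀ μ, pos x μ - x₀ μ < (x₁ μ - x₀ μ) + ((L ^ (i.m + i.K) : ℕ) : ℤ) := by
      intro x hx hxS
      refine ⟨fun μ => by have := (hS x hx hxS μ).1; linarith, fun μ => ?_⟩
      have := (hS x hx hxS μ).2
      have hc : ((Wd₁ : ℕ) : ℤ) ≤ ((L ^ (i.m + i.K) : ℕ) : ℤ) := by exact_mod_cast hWd₁
      linarith
    have hsup := supNorm_sub_le_tdist_shift i (a := fun μ => x₁ μ - x₀ μ) hx₁ (fun μ => by have := hx₀₁ μ; linarith)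
      (hsub₁ hx hxS).1 (hsub₁ hx' hx'S).1 (hsub₁ hx hxS).2 (hsub₁ hx' hx'S).2 (hwin hx) (hwin hx')
    have hsub : (fun μ => pos x μ - x₀ μ) - (fun μ => pos x' μ - x₀ μ) = pos x - pos x' := by
      funext μ
      simp only [Pi.sub_apply]
      ring
    rw [hsub] at hsup
    simp only [chartBond_src]
    set t := i.tdist (iterBlockOf i.j (siteOfInt i fun μ => pos x μ - x₀ μ)) (iterBlockOf i.j (siteOfInt i fun μ => pos x' μ - x₀ μ))
      with ht
    have htn : 0 ≤ t := i.tdist_nonneg _ _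
    have hdiv : supNorm (pos x - pos x') / ((L ^ i.j : ℕ) : ℝ) ≤ t + 1 := by
      rw [div_le_iff₀ hnpos]
      nlinarith
    have hdist : g.dist (blk x) (blk x') ≤ κ * t + (κ + c) := by
      have := hglob x hx x' hx' hxS hx'S
      nlinarith [mul_le_mul_of_nonneg_left hdiv hκ.le]
    exact expKernel_le_of_dist_le hA hδ hκ hdist

/-- **(2.133) FOR THE GENUINE TWO-SCALE `G_□` TRANSPLANTED THROUGH A LARGE (POSSIBLY BIJECTIVE) WINDOW** — the constants of v1's
`reach2133_G`; window side up to the full period `2L^{m+K}`, reach in a half-period sub-window.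
[cite: Balaban1984PropagatorsII, (2.133) p.247, Prop. 2.5 p.246, p.238 (T_□ = □̃³)] -/
theorem reach2133_G₂ (d L : ℕ) (hd : 1 ≤ d + 1) (hL : Odd L ∧ 1 < L) {a₀ a₁ : ℝ} (ha₀ : 0 < a₀) (ha₁ : a₀ ≤ a₁) :
    ∃ δ : ℝ, 0 < δ ∧ ∃ A : ℝ, 0 ≤ A ∧ ∀ (i : TSIdx d L hd hL a₀ a₁) {X : Type} [DecidableEq X] {g : B6.Geometry}
      (blk : X → g.Site) (S : Set g.Site) (pos : X → Fin (d + 1) → ℤ) (dir : X → Fin (d + 1)) (x₀ : Fin (d + 1) → ℤ)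
      {Wd : ℕ} (_ : Wd ≤ i.P.sitesPerDir 0) (W : Finset X) (_ : ∀ x ∈ W, InWindow pos x₀ Wd x)
      (_ : Set.InjOn (fun x => (pos x, dir x)) ↑W)
      (x₁ : Fin (d + 1) → ℤ) (_ : ∀ μ, ((L ^ i.j : ℕ) : ℤ) ∣ x₁ μ - x₀ μ) (_ : ∀ μ, x₀ μ ≤ x₁ μ) {Wd₁ : ℕ} (_ : Wd₁ ≤ L ^ (i.m + i.K))
      (_ : ∀ x ∈ W, blk x ∈ S → InWindow pos x₁ Wd₁ x) (κ c : ℝ) (_ : 0 < κ)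
      (_ : ∀ x ∈ W, ∀ x₁ ∈ W, blk x ∈ S → blk x₁ ∈ S →
        g.dist (blk x) (blk x₁) ≤ κ * (supNorm (pos x - pos x₁) / ((L ^ i.j : ℕ) : ℝ)) + c)
      (n : ℕ) (_ : ∀ y ∈ S, ∃ T : Finset (Site i.P i.j), T.card ≤ n ∧
        ∀ x ∈ W, blk x = y → iterBlockOf i.j (chartBond i pos dir x₀ x).src ∈ T),
      LocalMajorant blk (transplant W (chartBond i pos dir x₀) (onFun i.D.G)) S
        (fun a b => n * ((A * Real.exp (δ * (κ + c) / κ)) * Real.exp (-(δ / κ * g.dist a b)))) := by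
  obtain ⟨δ, hδ, A, hA, h⟩ := ineq2133_G d L hd hL ha₀ ha₁
  exact ⟨δ, hδ, A, hA, fun i X _ g blk S pos dir x₀ Wd hWd W hW hinj x₁ hx₁ hx₀₁ Wd₁ hWd₁ hS κ c hκ hglob n hfib =>
    localMajorant_transplant_of_window₂ i 0 0 blk S pos dir x₀ hWd W hW hinj x₁ hx₁ hx₀₁ hWd₁ hS hA hδ.le (h i 0 0) κ c hκ hglob n hfib⟩

/-- the same for `∇_λG_□`. [cite: Balaban1984PropagatorsII, (2.133) p.247, Prop. 2.5 p.246] -/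
theorem reach2133_DG₂ (d L : ℕ) (hd : 1 ≤ d + 1) (hL : Odd L ∧ 1 < L) {a₀ a₁ : ℝ} (ha₀ : 0 < a₀) (ha₁ : a₀ ≤ a₁) :
    ∃ δ : ℝ, 0 < δ ∧ ∃ A : ℝ, 0 ≤ A ∧ ∀ (i : TSIdx d L hd hL a₀ a₁) (lam : Fin i.P.d) {X : Type} [DecidableEq X] {g : B6.Geometry}
      (blk : X → g.Site) (S : Set g.Site) (pos : X → Fin (d + 1) → ℤ) (dir : X → Fin (d + 1)) (x₀ : Fin (d + 1) → ℤ)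
      {Wd : ℕ} (_ : Wd ≤ i.P.sitesPerDir 0) (W : Finset X) (_ : ∀ x ∈ W, InWindow pos x₀ Wd x)
      (_ : Set.InjOn (fun x => (pos x, dir x)) ↑W)
      (x₁ : Fin (d + 1) → ℤ) (_ : ∀ μ, ((L ^ i.j : ℕ) : ℤ) ∣ x₁ μ - x₀ μ) (_ : ∀ μ, x₀ μ ≤ x₁ μ) {Wd₁ : ℕ} (_ : Wd₁ ≤ L ^ (i.m + i.K))
      (_ : ∀ x ∈ W, blk x ∈ S → InWindow pos x₁ Wd₁ x) (κ c : ℝ) (_ : 0 < κ)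
      (_ : ∀ x ∈ W, ∀ x₁ ∈ W, blk x ∈ S → blk x₁ ∈ S →
        g.dist (blk x) (blk x₁) ≤ κ * (supNorm (pos x - pos x₁) / ((L ^ i.j : ℕ) : ℝ)) + c)
      (n : ℕ) (_ : ∀ y ∈ S, ∃ T : Finset (Site i.P i.j), T.card ≤ n ∧
        ∀ x ∈ W, blk x = y → iterBlockOf i.j (chartBond i pos dir x₀ x).src ∈ T),
      LocalMajorant blk (transplant W (chartBond i pos dir x₀) (onFun (i.Dl lam ∘ₗ i.D.G))) S
        (fun a b => n * ((A * Real.exp (δ * (κ + c) / κ)) * Real.exp (-(δ / κ * g.dist a b)))) := by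
  obtain ⟨δ, hδ, A, hA, h⟩ := ineq2133_DG d L hd hL ha₀ ha₁
  exact ⟨δ, hδ, A, hA, fun i lam X _ g blk S pos dir x₀ Wd hWd W hW hinj x₁ hx₁ hx₀₁ Wd₁ hWd₁ hS κ c hκ hglob n hfib =>
    localMajorant_transplant_of_window₂ i 0 0 blk S pos dir x₀ hWd W hW hinj x₁ hx₁ hx₀₁ hWd₁ hS hA hδ.le (h i 0 0 lam) κ c hκ hglob n hfib⟩

end ShiftedWindow

end Literature.MathematicalPhysics.QuantumFieldTheory.Balaban1983to89.B6Prop26ReachTransplant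

end
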